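import Mathlib
import HarnessLib
import Literature.ComputerArithmetic.JeannerodRump2018.Summation

/-!
# de Dinechin–Lauter–Muller–Torres: Ziv's rounding test (the "magic constant" theorem)

F. de Dinechin, C. Lauter, J.-M. Muller, S. Torres, *On Ziv's rounding test*, ACM Trans. Math. Software
39(4) (2013), Article 25 [DedinechinEtAl2013]. The quick phase of a correctly rounded elementary function
(Ziv's libultim, CR-LIBM, …) computes `y ≈ f(x)` as an unevaluated sum `yh + yℓ` of two precision-`p`
floating-point numbers with `|(yh + yℓ) − y| < ε·|y|` and `yh = RN(yh + yℓ)` (Problem 1, (3)–(4)), and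
decides whether `yh` is already the correctly rounded `RN(y)` by the test "is `yh` equal to
`RN(yh + RN(yℓ·e))`?" for a "magic constant" `e`. The paper's main result:

> **Theorem 2.1.** Assume that `yh` is a floating-point number such that `¼ulp(yh)` is in the normal
> range, and that `ε` is less than `1/(2^(p+1) + 1)`. Also assume that `yh = RN(yh + yℓ)` and
> `|(yh + yℓ) − y| < ε·|y|`, with `ε < 2^(−p−1)`. If `e ≥ (1 + 2^(−p)) / (1 − ε − 2^(p+1)·ε)` then
> `yh = RN(yh + RN(yℓ·e))` implies `yh = RN(y)`.

## Model and what is proved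

* Floating-point numbers: `IsFloat p x :⟺ x = M·2^E` with integers `|M| < 2^p`, `E` unrestricted — the
  "ideal system, with no overflows or underflows" `D_n` of [BrisebarreMuller2007, §1] ("results will
  remain true in an actual system, provided that no overflows or underflows occur"). This is the
  REAL-valued twin of `Literature.ComputerArithmetic.JeannerodRump2018.IsFloatU` / `IsRoundNearestU`
  (stated over `ℚ` there, which cannot host `y = f(x)` transcendental); `IsFloat.of_isFloatU` is the bridge. In this model the
  paper's hypothesis "¼ulp(yh) is in the normal range" is automatically satisfied; it is exactly the
  no-underflow proviso. `ulp(yh) = 2^(e−p+1)` for `2^e ≤ yh < 2^(e+1)`; the exponent `e` of `yh` is carried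
  explicitly.
* Rounding: the paper assumes IEEE round-to-nearest, ties-to-even (footnote 4). We quantify over ANY
  function `RN` that is a round-to-nearest into the precision-`p` floats (`IsRoundNearest p RN`: its values
  are floats and no float is closer to the argument). The published proof (Properties 1–7) only ever uses
  these two facts — every inequality that finally pins down `RN(y)` is strict — so Theorem 2.1 holds, and
  is proved here, for every round-to-nearest rule, ties-to-even included (`ziv_rounding_test`). Such
  functions exist: `roundNearest`, `isRoundNearest_roundNearest` (the hypothesis is not vacuous).
* Sign: "(3) and (4) imply that yh and y have the same sign. Without loss of generality, we assume that
  they are positive" — the main theorem takes `2^e ≤ yh < 2^(e+1)`; `ziv_rounding_test_of_neg` transports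
  it to `yh < 0` for rounding rules with `RN(−t) = −RN(t)` (ties-to-even, ties-away).

PROVED, following the paper's structure: spacing of the floats around `yh` (`exists_int_mul_of_le`,
`le_sub_of_lt`, `ulp_le_abs_sub`), Property 1 (inside `ziv_rounding_test`), the "test ⇒ |RN(yℓ e)| ≤
½ulp(yh)" steps of Properties 3/6 (`abs_le_half_ulp_of_test`, `le_half_ulp_of_test_pow2`,
`neg_le_quarter_ulp_of_test_pow2`), the step "(7) implies |yℓ·e| ≤ (1 + 2^(−p))·½ulp(yh)"
(`abs_le_of_abs_rn_le_two_zpow`), the conclusions "|yh − y| < ½ulp(yh) ⇒ yh = RN(y)" and its power-of-two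
variant (`rn_eq_of_abs_sub_lt_half_ulp`, `rn_eq_two_zpow`), and Theorem 2.1. Section 3 (Theorem 3.1
"when the test fails", Theorem 3.2 = the fma variant `RN(yh + yℓ·e)`), Ziv's strategy (§1.2.1) and the
ties-to-even rule (§1.1) are in the last section of this file (appended 2026-08-20). NOT here: §2.3
near-optimality examples, §3.3 (subnormal `¼ulp(yh)`), Table I.
-/

namespace Literature.ComputerArithmetic.DeDinechinLauterMullerTorres2013

/-! ### Precision-`p` binary floating-point numbers, unbounded exponent range -/

/-- `x` is a precision-`p` binary floating-point number (exponent range unbounded): `x = M·2^E` with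
`|M| < 2^p`. This is the set `D_n` (radix 2) of [BrisebarreMuller2007, §1], written without the
normalisation `2^(p−1) ≤ |M|` (the SET is the same: shift `M`). [cite: BrisebarreMuller2007, §1] -/
def IsFloat (p : ℕ) (x : ℝ) : Prop := ∃ M E : ℤ, |M| < 2 ^ p ∧ x = (M : ℝ) * (2 : ℝ) ^ E

namespace IsFloat

variable {p : ℕ}

/-- `K·2^E` is a float as soon as `|K| ≤ 2^p` (for `|K| = 2^p` use `(K/2)·2^(E+1)`).
[cite: BrisebarreMuller2007, §1] -/
theorem of_abs_le (hp : 1 ≤ p) {K E : ℤ} (hK : |K| ≤ 2 ^ p) : IsFloat p ((K : ℝ) * (2 : ℝ) ^ E) := by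
  rcases hK.lt_or_eq with hlt | heq
  · exact ⟨K, E, hlt, rfl⟩
  · obtain ⟨p', rfl⟩ : ∃ p', p = p' + 1 := ⟨p - 1, by omega⟩
    have hlt : |(2 : ℤ) ^ p'| < 2 ^ (p' + 1) := by
      rw [abs_of_nonneg (by positivity)]; exact pow_lt_pow_right₀ (by norm_num) (by omega)
    rcases (abs_eq (by positivity : (0 : ℤ) ≤ 2 ^ (p' + 1))).1 heq with h | h
    · refine ⟨2 ^ p', E + 1, hlt, ?_⟩
      rw [h, zpow_add_one₀ (by norm_num : (2 : ℝ) ≠ 0)]; push_cast; ring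
    · refine ⟨-(2 ^ p'), E + 1, by rwa [abs_neg], ?_⟩
      rw [h, zpow_add_one₀ (by norm_num : (2 : ℝ) ≠ 0)]; push_cast; ring

/-- Powers of two are floats (`p ≥ 1`). [cite: BrisebarreMuller2007, §1] -/
theorem two_zpow (hp : 1 ≤ p) (E : ℤ) : IsFloat p ((2 : ℝ) ^ E) := by
  have h := of_abs_le hp (K := 1) (E := E) (by rw [abs_one]; exact one_le_pow₀ (by norm_num))
  simpa using h

/-- Floats are closed under negation. [cite: BrisebarreMuller2007, §1] -/
theorem neg {x : ℝ} (hx : IsFloat p x) : IsFloat p (-x) := by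
  obtain ⟨M, E, hM, rfl⟩ := hx
  exact ⟨-M, E, by rwa [abs_neg], by push_cast; ring⟩

/-- Bridge: a rational unbounded-exponent float in the sense of
`Literature.ComputerArithmetic.JeannerodRump2018.IsFloatU` is a real float of the same precision.
[cite: BrisebarreMuller2007, §1] -/
theorem of_isFloatU {q : ℚ} (h : JeannerodRump2018.IsFloatU p q) : IsFloat p (q : ℝ) := by
  obtain ⟨M, E, hM, rfl⟩ := h
  exact ⟨M, E, hM, by push_cast; rfl⟩

/-- SPACING ABOVE `2^e`: a float of magnitude `≥ 2^e` is an integer multiple of `2^(e−p+1)` (the ulp of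
the binade `[2^e, 2^(e+1))`). [cite: DedinechinEtAl2013, §2.1] -/
theorem exists_int_mul_of_le {f : ℝ} (hf : IsFloat p f) {e : ℤ} (he : (2 : ℝ) ^ e ≤ |f|) :
    ∃ K : ℤ, f = (K : ℝ) * (2 : ℝ) ^ (e - p + 1) := by
  obtain ⟨M, E, hM, rfl⟩ := hf
  have hM' : (|M| : ℝ) < (2 : ℝ) ^ (p : ℤ) := by rw [zpow_natCast]; exact_mod_cast hM
  have h2E : (0 : ℝ) < (2 : ℝ) ^ E := by positivity
  have hlt : (2 : ℝ) ^ e < (2 : ℝ) ^ ((p : ℤ) + E) := by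
    calc (2 : ℝ) ^ e ≤ |(M : ℝ) * 2 ^ E| := he
      _ = |(M : ℝ)| * 2 ^ E := by rw [abs_mul, abs_of_pos h2E]
      _ < 2 ^ (p : ℤ) * 2 ^ E := by
          exact mul_lt_mul_of_pos_right hM' h2E
      _ = 2 ^ ((p : ℤ) + E) := by rw [zpow_add₀ (by norm_num)]
  have hexp : e < (p : ℤ) + E := (zpow_lt_zpow_iff_right₀ (by norm_num : (1 : ℝ) < 2)).1 hlt
  obtain ⟨d, hd⟩ : ∃ d : ℕ, E = (e - p + 1) + d := ⟨(E - (e - p + 1)).toNat, by omega⟩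
  refine ⟨M * 2 ^ d, ?_⟩
  rw [hd, zpow_add₀ (by norm_num), zpow_natCast]; push_cast; ring

/-- SPACING BELOW `2^e`: a float `< 2^e` is at most `2^e − 2^(e−p)` (the predecessor of `2^e`).
[cite: DedinechinEtAl2013, §2.1] -/
theorem le_sub_of_lt (hp : 1 ≤ p) {f : ℝ} (hf : IsFloat p f) {e : ℤ} (he : f < (2 : ℝ) ^ e) :
    f ≤ (2 : ℝ) ^ e - (2 : ℝ) ^ (e - p) := by
  have h2 : (2 : ℝ) ^ (e - p) * 2 ^ (p : ℤ) = 2 ^ e := by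
    rw [← zpow_add₀ (by norm_num)]; congr 1; ring
  have hp1 : (2 : ℝ) ≤ (2 : ℝ) ^ (p : ℤ) := by
    rw [zpow_natCast]
    calc (2 : ℝ) = 2 ^ 1 := by norm_num
      _ ≤ 2 ^ p := pow_le_pow_right₀ (by norm_num) hp
  have hpos : (0 : ℝ) < (2 : ℝ) ^ (e - p) := by positivity
  rcases le_or_gt f 0 with hf0 | hf0
  · have : (2 : ℝ) ^ (e - p) * 2 ≤ 2 ^ e := by rw [← h2]; exact mul_le_mul_of_nonneg_left hp1 hpos.le
    linarith
  · obtain ⟨M, E, hM, rfl⟩ := hf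
    have h2E : (0 : ℝ) < (2 : ℝ) ^ E := by positivity
    have hMpos : (0 : ℝ) < M := by
      by_contra h; push Not at h
      have := mul_nonpos_of_nonpos_of_nonneg h h2E.le
      linarith
    have hMle : (M : ℝ) ≤ (2 : ℝ) ^ (p : ℤ) - 1 := by
      have : M ≤ 2 ^ p - 1 := by have := (abs_lt.1 hM).2; omega
      have h' : (M : ℝ) ≤ ((2 ^ p - 1 : ℤ) : ℝ) := by exact_mod_cast this
      rw [zpow_natCast]; push_cast at h'; exact h'
    rcases le_or_gt E (e - p) with hE | hE
    · -- E ≤ e - p: f ≤ (2^p - 1) 2^E ≤ (2^p - 1) 2^(e-p)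
      have hEle : (2 : ℝ) ^ E ≤ 2 ^ (e - p) := zpow_le_zpow_right₀ (by norm_num) hE
      calc (M : ℝ) * 2 ^ E ≤ ((2 : ℝ) ^ (p : ℤ) - 1) * 2 ^ E :=
            mul_le_mul_of_nonneg_right hMle h2E.le
        _ ≤ ((2 : ℝ) ^ (p : ℤ) - 1) * 2 ^ (e - p) :=
            mul_le_mul_of_nonneg_left hEle (by linarith)
        _ = 2 ^ e - 2 ^ (e - p) := by rw [← h2]; ring
    · -- E ≥ e - p + 1: f is a multiple K·u of u = 2^(e-p+1), with K < 2^(p-1)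
      obtain ⟨d, hd⟩ : ∃ d : ℕ, E = (e - p + 1) + d := ⟨(E - (e - p + 1)).toNat, by omega⟩
      obtain ⟨p', rfl⟩ : ∃ p', p = p' + 1 := ⟨p - 1, by omega⟩
      have hu : (0 : ℝ) < (2 : ℝ) ^ (e - (p' + 1 : ℕ) + 1) := by positivity
      have he2 : (2 : ℝ) ^ e = ((2 ^ p' : ℤ) : ℝ) * (2 : ℝ) ^ (e - (p' + 1 : ℕ) + 1) := by
        push_cast; rw [← zpow_natCast, ← zpow_add₀ (by norm_num)]; congr 1; ring
      have hv : (2 : ℝ) ^ (e - (p' + 1 : ℕ)) * 2 = (2 : ℝ) ^ (e - (p' + 1 : ℕ) + 1) := by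
        rw [zpow_add_one₀ (by norm_num : (2 : ℝ) ≠ 0)]
      have hf' : (M : ℝ) * 2 ^ E = ((M * 2 ^ d : ℤ) : ℝ) * (2 : ℝ) ^ (e - (p' + 1 : ℕ) + 1) := by
        rw [hd, zpow_add₀ (by norm_num), zpow_natCast]; push_cast; ring
      rw [hf'] at he ⊢
      rw [he2] at he
      have hK : M * 2 ^ d < 2 ^ p' := by
        have := lt_of_mul_lt_mul_right he hu.le
        exact_mod_cast this
      have hK' : ((M * 2 ^ d : ℤ) : ℝ) ≤ ((2 ^ p' : ℤ) : ℝ) - 1 := by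
        have : M * 2 ^ d ≤ 2 ^ p' - 1 := by omega
        have h' : ((M * 2 ^ d : ℤ) : ℝ) ≤ ((2 ^ p' - 1 : ℤ) : ℝ) := by exact_mod_cast this
        push_cast at h' ⊢; exact h'
      have hmul := mul_le_mul_of_nonneg_right hK' hu.le
      rw [sub_mul, one_mul, ← he2] at hmul
      linarith

end IsFloat

/-! ### Round-to-nearest functions into the precision-`p` floats -/

/-- `RN` is a round-to-nearest into the precision-`p` floats: every `RN t` is a float and no float is
closer to `t` (any tie-breaking rule; IEEE roundTiesToEven is one such function).
[cite: DedinechinEtAl2013, §1.4] -/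
structure IsRoundNearest (p : ℕ) (RN : ℝ → ℝ) : Prop where
  isFloat : ∀ t : ℝ, IsFloat p (RN t)
  nearest : ∀ t f : ℝ, IsFloat p f → |RN t - t| ≤ |f - t|

namespace IsRoundNearest

variable {p : ℕ} {RN : ℝ → ℝ}

/-- A float strictly closer to `t` than every other float IS `RN t`. [cite: DedinechinEtAl2013, §2.1] -/
theorem eq_of_forall_lt (h : IsRoundNearest p RN) {t x : ℝ} (hx : IsFloat p x)
    (hlt : ∀ f : ℝ, IsFloat p f → f ≠ x → |x - t| < |f - t|) : RN t = x := by
  by_contra hne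
  have h1 := hlt (RN t) (h.isFloat t) hne
  have h2 := h.nearest t x hx
  linarith

/-- `RN` preserves the sign: `0 ≤ t ⇒ 0 ≤ RN t`. [cite: DedinechinEtAl2013, §1.4] -/
theorem nonneg (h : IsRoundNearest p RN) {t : ℝ} (ht : 0 ≤ t) : 0 ≤ RN t := by
  have h0 := h.nearest t 0 ⟨0, 0, by simp, by simp⟩
  rw [zero_sub, abs_neg, abs_of_nonneg ht] at h0
  have := (abs_le.1 h0).1
  linarith

/-- `t ≤ 0 ⇒ RN t ≤ 0`. [cite: DedinechinEtAl2013, §1.4] -/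
theorem nonpos (h : IsRoundNearest p RN) {t : ℝ} (ht : t ≤ 0) : RN t ≤ 0 := by
  have h0 := h.nearest t 0 ⟨0, 0, by simp, by simp⟩
  rw [zero_sub, abs_neg, abs_of_nonpos ht] at h0
  have := (abs_le.1 h0).2
  linarith

/-- The mirrored function `t ↦ −RN(−t)` is again a round-to-nearest. [cite: DedinechinEtAl2013, §1.4] -/
theorem mirror (h : IsRoundNearest p RN) : IsRoundNearest p (fun t => -RN (-t)) where
  isFloat t := (h.isFloat (-t)).neg
  nearest t f hf := by
    have h1 := h.nearest (-t) (-f) hf.neg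
    have e1 : |-RN (-t) - t| = |RN (-t) - -t| := by
      rw [← abs_neg]; congr 1; ring
    have e2 : |-f - -t| = |f - t| := by
      rw [← abs_neg]; congr 1; ring
    rw [e1, ← e2]; exact h1

/-- **"(7) implies |yℓ·e| ≤ (1 + 2^(−p))·½ulp(yh)"** (proof of Property 3; likewise in Property 6):
if `RN w ≤ 2^k` then `w ≤ 2^k·(1 + 2^(−p))` — otherwise the float `2^k + 2^(k−p+1)` would be closer to `w`
than `RN w` is. [cite: DedinechinEtAl2013, Property 3] -/
theorem le_of_rn_le_two_zpow (h : IsRoundNearest p RN) (hp : 1 ≤ p) {w : ℝ} {k : ℤ}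
    (hw : RN w ≤ (2 : ℝ) ^ k) : w ≤ (2 : ℝ) ^ k * (1 + (2 : ℝ) ^ (-(p : ℤ))) := by
  by_contra hlt
  push Not at hlt
  have h2k : (0 : ℝ) < (2 : ℝ) ^ k := by positivity
  -- the float B' = 2^k + 2^(k-p+1) = (2^(p-1) + 1) · 2^(k-p+1)
  obtain ⟨p', rfl⟩ : ∃ p', p = p' + 1 := ⟨p - 1, by omega⟩
  have hD : (2 : ℝ) ^ (k - (p' + 1 : ℕ) + 1) = 2 * ((2 : ℝ) ^ k * (2 : ℝ) ^ (-((p' + 1 : ℕ) : ℤ))) := by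
    rw [← zpow_add₀ (by norm_num), ← zpow_one_add₀ (by norm_num : (2 : ℝ) ≠ 0)]; congr 1; ring
  have hDpos : (0 : ℝ) < (2 : ℝ) ^ (k - (p' + 1 : ℕ) + 1) := by positivity
  have hB' : IsFloat (p' + 1) ((2 : ℝ) ^ k + (2 : ℝ) ^ (k - (p' + 1 : ℕ) + 1)) := by
    have hK : |((2 : ℤ) ^ p' + 1)| ≤ 2 ^ (p' + 1) := by
      rw [abs_of_nonneg (by positivity), pow_succ]
      have := one_le_pow₀ (M₀ := ℤ) (a := 2) (by norm_num) (n := p')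
      linarith
    have hf := IsFloat.of_abs_le (p := p' + 1) (by omega) (E := k - (p' + 1 : ℕ) + 1) hK
    have hk : (2 : ℝ) ^ k = (2 : ℝ) ^ (p' : ℤ) * (2 : ℝ) ^ (k - (p' + 1 : ℕ) + 1) := by
      rw [← zpow_add₀ (by norm_num)]; congr 1; push_cast; ring
    have e : (2 : ℝ) ^ k + (2 : ℝ) ^ (k - (p' + 1 : ℕ) + 1)
        = (((2 : ℤ) ^ p' + 1 : ℤ) : ℝ) * (2 : ℝ) ^ (k - (p' + 1 : ℕ) + 1) := by
      rw [hk]; push_cast; rw [← zpow_natCast]; ring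
    rw [e]; exact hf
  have hnear := h.nearest w _ hB'
  have hlow : w - RN w ≤ |RN w - w| := by rw [abs_sub_comm]; exact le_abs_self _
  rcases le_or_gt w ((2 : ℝ) ^ k + (2 : ℝ) ^ (k - (p' + 1 : ℕ) + 1)) with hwB | hwB
  · rw [abs_of_nonneg (show (0 : ℝ) ≤ (2 : ℝ) ^ k + (2 : ℝ) ^ (k - (p' + 1 : ℕ) + 1) - w by linarith)]
      at hnear
    rw [hD] at hnear hwB
    linarith
  · rw [abs_of_neg (show (2 : ℝ) ^ k + (2 : ℝ) ^ (k - (p' + 1 : ℕ) + 1) - w < 0 by linarith)] at hnear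
    linarith

/-- Symmetric form: `|RN w| ≤ 2^k ⇒ |w| ≤ 2^k·(1 + 2^(−p))`. [cite: DedinechinEtAl2013, Property 3] -/
theorem abs_le_of_abs_rn_le_two_zpow (h : IsRoundNearest p RN) (hp : 1 ≤ p) {w : ℝ} {k : ℤ}
    (hw : |RN w| ≤ (2 : ℝ) ^ k) : |w| ≤ (2 : ℝ) ^ k * (1 + (2 : ℝ) ^ (-(p : ℤ))) := by
  rw [abs_le]
  refine ⟨?_, h.le_of_rn_le_two_zpow hp (abs_le.1 hw).2⟩
  have h1 : (fun t => -RN (-t)) (-w) ≤ (2 : ℝ) ^ k := by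
    simp only [neg_neg]; linarith [(abs_le.1 hw).1]
  have := h.mirror.le_of_rn_le_two_zpow hp h1
  linarith

/-! #### Floats around `yh ∈ [2^e, 2^(e+1))`; `ulp(yh) = 2^(e−p+1)` -/

/-- Distance from a float `yh > 2^e` (in particular a `yh ∈ [2^e, 2^(e+1))` that is NOT a power of two)
to any other float is at least `2^(e−p+1) = ulp` of the binade `[2^e, 2^(e+1))`.
[cite: DedinechinEtAl2013, §2.1.1] -/
theorem ulp_le_abs_sub (hp : 1 ≤ p) {yh f : ℝ} {e : ℤ} (hyh : IsFloat p yh) (hf : IsFloat p f)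
    (he : (2 : ℝ) ^ e < yh) (hne : f ≠ yh) :
    (2 : ℝ) ^ (e - p + 1) ≤ |f - yh| := by
  have hu : (0 : ℝ) < (2 : ℝ) ^ (e - p + 1) := by positivity
  have h2e : (0 : ℝ) < (2 : ℝ) ^ e := by positivity
  have he2 : (2 : ℝ) ^ e = ((2 ^ (p - 1) : ℤ) : ℝ) * (2 : ℝ) ^ (e - p + 1) := by
    obtain ⟨p', rfl⟩ : ∃ p', p = p' + 1 := ⟨p - 1, by omega⟩
    push_cast; rw [← zpow_natCast, ← zpow_add₀ (by norm_num)]; congr 1; ring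
  obtain ⟨K, hK⟩ := hyh.exists_int_mul_of_le (e := e) (by rw [abs_of_pos (by linarith)]; exact he.le)
  rcases le_or_gt ((2 : ℝ) ^ e) f with hfe | hfe
  · -- f ≥ 2^e: both are multiples of u
    obtain ⟨L, hL⟩ := hf.exists_int_mul_of_le (e := e) (by rw [abs_of_pos (by linarith)]; exact hfe)
    have hKL : L ≠ K := by rintro rfl; exact hne (by rw [hL, hK])
    have h1 : (1 : ℝ) ≤ ((|L - K| : ℤ) : ℝ) := by exact_mod_cast Int.one_le_abs (sub_ne_zero.2 hKL)
    rw [hK, hL, ← sub_mul, abs_mul, abs_of_pos hu, ← Int.cast_sub, ← Int.cast_abs]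
    exact le_mul_of_one_le_left hu.le h1
  · -- f < 2^e ≤ yh - u
    have hfle := hf.le_sub_of_lt hp hfe
    have hK1 : (2 ^ (p - 1) : ℤ) < K := by
      have : ((2 ^ (p - 1) : ℤ) : ℝ) * (2 : ℝ) ^ (e - p + 1) < K * (2 : ℝ) ^ (e - p + 1) := by
        rw [← he2, ← hK]; exact he
      exact_mod_cast lt_of_mul_lt_mul_right this hu.le
    have hyu : (2 : ℝ) ^ e + (2 : ℝ) ^ (e - p + 1) ≤ yh := by
      have h' : (((2 ^ (p - 1) : ℤ) + 1 : ℤ) : ℝ) ≤ K := by exact_mod_cast hK1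
      have hmul := mul_le_mul_of_nonneg_right h' hu.le
      rw [hK, he2]; push_cast at hmul ⊢; linarith
    have hpos : (0 : ℝ) < (2 : ℝ) ^ (e - p) := by positivity
    rw [abs_sub_comm, abs_of_pos (by linarith)]
    linarith

/-- **"|yh − y| < ½ulp(yh), which implies yh = RN(y)"** for a float `yh > 2^e`, `ulp = 2^(e−p+1)` (used
for `yh ∈ (2^e, 2^(e+1))`, i.e. not a power of two; Properties 1, 2, 4). [cite: DedinechinEtAl2013, Property 2] -/
theorem rn_eq_of_abs_sub_lt_half_ulp (h : IsRoundNearest p RN) (hp : 1 ≤ p) {yh y : ℝ} {e : ℤ}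
    (hyh : IsFloat p yh) (he : (2 : ℝ) ^ e < yh)
    (hy : |yh - y| < (2 : ℝ) ^ (e - p + 1) / 2) : RN y = yh := by
  refine h.eq_of_forall_lt hyh fun f hf hne => ?_
  have hsp := ulp_le_abs_sub hp hyh hf he hne
  have htri : |f - yh| ≤ |f - y| + |yh - y| := by
    calc |f - yh| = |(f - y) - (yh - y)| := by ring_nf
      _ ≤ |f - y| + |yh - y| := abs_sub _ _
  linarith

/-- Around a power of two `yh = 2^e` the floats are `…, 2^e − 2^(e−p), 2^e, 2^e + 2^(e−p+1), …`, so
`yh = RN(y)` as soon as `−¼ulp(yh) < y − yh < ½ulp(yh)` (§2.1.2 items (1)–(3), Property 5).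
[cite: DedinechinEtAl2013, §2.1.2] -/
theorem rn_eq_two_zpow (h : IsRoundNearest p RN) (hp : 1 ≤ p) {y : ℝ} {e : ℤ}
    (hlo : (2 : ℝ) ^ e - (2 : ℝ) ^ (e - p + 1) / 4 < y)
    (hhi : y < (2 : ℝ) ^ e + (2 : ℝ) ^ (e - p + 1) / 2) : RN y = (2 : ℝ) ^ e := by
  have hu4 : (2 : ℝ) ^ (e - p + 1) / 4 = (2 : ℝ) ^ (e - p) / 2 := by
    rw [zpow_add_one₀ (by norm_num : (2 : ℝ) ≠ 0)]; ring
  have hv : (0 : ℝ) < (2 : ℝ) ^ (e - p) := by positivity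
  have hu : (0 : ℝ) < (2 : ℝ) ^ (e - p + 1) := by positivity
  have h2e : (0 : ℝ) < (2 : ℝ) ^ e := by positivity
  rw [hu4] at hlo
  refine h.eq_of_forall_lt (IsFloat.two_zpow hp e) fun f hf hne => ?_
  rcases lt_or_gt_of_ne hne with hlt | hgt
  · -- f < 2^e ⇒ f ≤ 2^e - 2^(e-p)
    have hfle := hf.le_sub_of_lt hp hlt
    have hfy : |f - y| = y - f := by rw [abs_of_neg (by linarith)]; ring
    rw [hfy, abs_sub_lt_iff]
    constructor <;> linarith
  · -- f > 2^e ⇒ f ≥ 2^e + u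
    obtain ⟨L, hL⟩ := hf.exists_int_mul_of_le (e := e) (by rw [abs_of_pos (by linarith)]; exact hgt.le)
    have he2 : (2 : ℝ) ^ e = ((2 ^ (p - 1) : ℤ) : ℝ) * (2 : ℝ) ^ (e - p + 1) := by
      obtain ⟨p', rfl⟩ : ∃ p', p = p' + 1 := ⟨p - 1, by omega⟩
      push_cast; rw [← zpow_natCast, ← zpow_add₀ (by norm_num)]; congr 1; ring
    have hL1 : (2 ^ (p - 1) : ℤ) < L := by
      have : ((2 ^ (p - 1) : ℤ) : ℝ) * (2 : ℝ) ^ (e - p + 1) < L * (2 : ℝ) ^ (e - p + 1) := by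
        rw [← he2, ← hL]; exact hgt
      exact_mod_cast lt_of_mul_lt_mul_right this hu.le
    have hfge : (2 : ℝ) ^ e + (2 : ℝ) ^ (e - p + 1) ≤ f := by
      have h' : (((2 ^ (p - 1) : ℤ) + 1 : ℤ) : ℝ) ≤ L := by exact_mod_cast hL1
      have hmul := mul_le_mul_of_nonneg_right h' hu.le
      rw [hL, he2]; push_cast at hmul ⊢; linarith
    have hfy : |f - y| = f - y := abs_of_pos (by linarith)
    rw [hfy, abs_sub_lt_iff]
    constructor <;> linarith

/-- **Proof of Property 3, first step:** for `yh` not a power of two, `yh = RN(yh + z)` forces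
`|z| ≤ ½ulp(yh)` (both neighbours `yh ± ulp(yh)` are floats). [cite: DedinechinEtAl2013, Property 3] -/
theorem abs_le_half_ulp_of_test (h : IsRoundNearest p RN) (hp : 1 ≤ p) {yh z : ℝ} {e : ℤ}
    (hyh : IsFloat p yh) (he : (2 : ℝ) ^ e < yh) (he' : yh < (2 : ℝ) ^ (e + 1))
    (htest : RN (yh + z) = yh) : |z| ≤ (2 : ℝ) ^ (e - p + 1) / 2 := by
  have hu : (0 : ℝ) < (2 : ℝ) ^ (e - p + 1) := by positivity
  have h2e : (0 : ℝ) < (2 : ℝ) ^ e := by positivity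
  have he2 : (2 : ℝ) ^ (e + 1) = ((2 ^ p : ℤ) : ℝ) * (2 : ℝ) ^ (e - p + 1) := by
    push_cast; rw [← zpow_natCast, ← zpow_add₀ (by norm_num)]; congr 1; ring
  obtain ⟨K, hK⟩ := hyh.exists_int_mul_of_le (e := e) (by rw [abs_of_pos (by linarith)]; exact he.le)
  have hKp : K < 2 ^ p := by
    have : (K : ℝ) * (2 : ℝ) ^ (e - p + 1) < ((2 ^ p : ℤ) : ℝ) * (2 : ℝ) ^ (e - p + 1) := by
      rw [← he2, ← hK]; exact he'
    exact_mod_cast lt_of_mul_lt_mul_right this hu.le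
  have hK0 : 0 < K := by
    have : (0 : ℝ) < K := by
      by_contra hle; push Not at hle
      have := mul_nonpos_of_nonpos_of_nonneg hle hu.le
      linarith
    exact_mod_cast this
  -- the two neighbours yh ± u
  have hsucc : IsFloat p (yh + (2 : ℝ) ^ (e - p + 1)) := by
    have hf := IsFloat.of_abs_le hp (K := K + 1) (E := e - p + 1)
      (by rw [abs_of_pos (by linarith)]; exact Int.add_one_le_iff.mpr hKp)
    have e1 : yh + (2 : ℝ) ^ (e - p + 1) = ((K + 1 : ℤ) : ℝ) * (2 : ℝ) ^ (e - p + 1) := by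
      rw [hK]; push_cast; ring
    rw [e1]; exact hf
  have hpred : IsFloat p (yh - (2 : ℝ) ^ (e - p + 1)) := by
    have hf := IsFloat.of_abs_le hp (K := K - 1) (E := e - p + 1)
      (by rw [abs_of_nonneg (by linarith)]; linarith)
    have e1 : yh - (2 : ℝ) ^ (e - p + 1) = ((K - 1 : ℤ) : ℝ) * (2 : ℝ) ^ (e - p + 1) := by
      rw [hK]; push_cast; ring
    rw [e1]; exact hf
  have h1 := h.nearest (yh + z) _ hsucc
  have h2 := h.nearest (yh + z) _ hpred
  rw [htest] at h1 h2
  have ez : |yh - (yh + z)| = |z| := by rw [← abs_neg]; congr 1; ring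
  rw [ez] at h1 h2
  rw [show yh + (2 : ℝ) ^ (e - p + 1) - (yh + z) = (2 : ℝ) ^ (e - p + 1) - z by ring] at h1
  rw [show yh - (2 : ℝ) ^ (e - p + 1) - (yh + z) = -((2 : ℝ) ^ (e - p + 1) + z) by ring, abs_neg] at h2
  rcases le_or_gt 0 z with hz | hz
  · rw [abs_of_nonneg hz] at h1 ⊢
    rcases le_or_gt z ((2 : ℝ) ^ (e - p + 1)) with hzu | hzu
    · rw [abs_of_nonneg (by linarith)] at h1; linarith
    · rw [abs_of_neg (by linarith)] at h1; linarith
  · rw [abs_of_neg hz] at h2 ⊢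
    rcases le_or_gt (-z) ((2 : ℝ) ^ (e - p + 1)) with hzu | hzu
    · rw [abs_of_nonneg (by linarith)] at h2; linarith
    · rw [abs_of_neg (by linarith)] at h2; linarith

/-- §2.1.2 item (1): for `yh = 2^e` and `z ≥ 0`, `yh = RN(yh + z)` forces `z ≤ ½ulp(yh)`.
[cite: DedinechinEtAl2013, §2.1.2] -/
theorem le_half_ulp_of_test_pow2 (h : IsRoundNearest p RN) (hp : 1 ≤ p) {z : ℝ} {e : ℤ}
    (hz : 0 ≤ z) (htest : RN ((2 : ℝ) ^ e + z) = (2 : ℝ) ^ e) : z ≤ (2 : ℝ) ^ (e - p + 1) / 2 := by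
  have hu : (0 : ℝ) < (2 : ℝ) ^ (e - p + 1) := by positivity
  have he2 : (2 : ℝ) ^ e = ((2 ^ (p - 1) : ℤ) : ℝ) * (2 : ℝ) ^ (e - p + 1) := by
    obtain ⟨p', rfl⟩ : ∃ p', p = p' + 1 := ⟨p - 1, by omega⟩
    push_cast; rw [← zpow_natCast, ← zpow_add₀ (by norm_num)]; congr 1; ring
  have hsucc : IsFloat p ((2 : ℝ) ^ e + (2 : ℝ) ^ (e - p + 1)) := by
    have hK : |(2 : ℤ) ^ (p - 1) + 1| ≤ 2 ^ p := by
      obtain ⟨p', rfl⟩ : ∃ p', p = p' + 1 := ⟨p - 1, by omega⟩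
      rw [Nat.add_sub_cancel, abs_of_nonneg (by positivity), pow_succ]
      have := one_le_pow₀ (M₀ := ℤ) (a := 2) (by norm_num) (n := p')
      linarith
    have hf := IsFloat.of_abs_le hp (E := e - p + 1) hK
    have e1 : (2 : ℝ) ^ e + (2 : ℝ) ^ (e - p + 1) = (((2 : ℤ) ^ (p - 1) + 1 : ℤ) : ℝ) * (2 : ℝ) ^ (e - p + 1) := by
      rw [he2]; push_cast; ring
    rw [e1]; exact hf
  have h1 := h.nearest ((2 : ℝ) ^ e + z) _ hsucc
  have ez : |(2 : ℝ) ^ e - ((2 : ℝ) ^ e + z)| = z := by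
    rw [show (2 : ℝ) ^ e - ((2 : ℝ) ^ e + z) = -z by ring, abs_neg, abs_of_nonneg hz]
  rw [htest, ez, show (2 : ℝ) ^ e + (2 : ℝ) ^ (e - p + 1) - ((2 : ℝ) ^ e + z)
    = (2 : ℝ) ^ (e - p + 1) - z by ring] at h1
  rcases le_or_gt z ((2 : ℝ) ^ (e - p + 1)) with hzu | hzu
  · rw [abs_of_nonneg (by linarith)] at h1; linarith
  · rw [abs_of_neg (by linarith)] at h1; linarith

/-- **Proof of Property 6, first step:** for `yh = 2^e` and `z ≤ 0`, `yh = RN(yh + z)` forces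
`|z| ≤ ¼ulp(yh) = 2^(−p−1)·yh` (the predecessor of `2^e` is `2^e − ½ulp(yh)`).
[cite: DedinechinEtAl2013, Property 6] -/
theorem neg_le_quarter_ulp_of_test_pow2 (h : IsRoundNearest p RN) {z : ℝ} {e : ℤ}
    (hz : z ≤ 0) (htest : RN ((2 : ℝ) ^ e + z) = (2 : ℝ) ^ e) : -z ≤ (2 : ℝ) ^ (e - p + 1) / 4 := by
  have hu4 : (2 : ℝ) ^ (e - p + 1) / 4 = (2 : ℝ) ^ (e - p) / 2 := by
    rw [zpow_add_one₀ (by norm_num : (2 : ℝ) ≠ 0)]; ring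
  have hv : (0 : ℝ) < (2 : ℝ) ^ (e - p) := by positivity
  have he2 : (2 : ℝ) ^ e = ((2 ^ p : ℤ) : ℝ) * (2 : ℝ) ^ (e - p) := by
    push_cast; rw [← zpow_natCast, ← zpow_add₀ (by norm_num)]; congr 1; ring
  -- predecessor 2^e - 2^(e-p) = (2^p - 1) · 2^(e-p)
  have hpred : IsFloat p ((2 : ℝ) ^ e - (2 : ℝ) ^ (e - p)) := by
    have h1 : (1 : ℤ) ≤ 2 ^ p := one_le_pow₀ (by norm_num)
    refine ⟨2 ^ p - 1, e - p, ?_, ?_⟩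
    · rw [abs_of_nonneg (by linarith)]; linarith
    · rw [he2]; push_cast; ring
  have h1 := h.nearest ((2 : ℝ) ^ e + z) _ hpred
  have ez : |(2 : ℝ) ^ e - ((2 : ℝ) ^ e + z)| = -z := by
    rw [show (2 : ℝ) ^ e - ((2 : ℝ) ^ e + z) = -z by ring, abs_of_nonneg (by linarith)]
  rw [htest, ez, show (2 : ℝ) ^ e - (2 : ℝ) ^ (e - p) - ((2 : ℝ) ^ e + z)
    = -((2 : ℝ) ^ (e - p) + z) by ring, abs_neg] at h1
  rw [hu4]
  rcases le_or_gt 0 ((2 : ℝ) ^ (e - p) + z) with hvz | hvz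
  · rw [abs_of_nonneg hvz] at h1; linarith
  · rw [abs_of_neg hvz] at h1; linarith

end IsRoundNearest

/-! ### Theorem 2.1 -/

section Main

variable {p : ℕ} {RN : ℝ → ℝ}

/-- **Theorem 2.1 of [DedinechinEtAl2013] (Ziv's rounding test is correct with the magic constant
`e ≥ (1 + 2^(−p))/(1 − ε − 2^(p+1)ε)`), case `yh > 0`.** Precision `p ≥ 2`; `RN` any round-to-nearest
into the precision-`p` floats; `yh` a float with exponent `e` (`2^e ≤ yh < 2^(e+1)`; exponents are
unbounded — the paper's proviso "¼ulp(yh) is in the normal range"); `ε < 1/(2^(p+1) + 1)`;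
(4) `yh = RN(yh + yℓ)`; (3) `|(yh + yℓ) − y| < ε·|y|`; magic constant `c ≥ (1 + 2^(−p))/(1 − ε − 2^(p+1)ε)`.
Then `yh = RN(yh + RN(yℓ·c))` implies `yh = RN(y)`. The proof is the paper's: Property 1 (signs),
Properties 2–4 (`yh` not a power of two), §2.1.2 (1)–(3) with Properties 5–7 (`yh = 2^e`).
[cite: DedinechinEtAl2013, Theorem 2.1] -/
theorem ziv_rounding_test (hp : 2 ≤ p) (hRN : IsRoundNearest p RN) {y yh yl ε c : ℝ} {e : ℤ}
    (hyh : IsFloat p yh) (he : (2 : ℝ) ^ e ≤ yh) (he' : yh < (2 : ℝ) ^ (e + 1))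
    (hε : ε < 1 / (2 ^ (p + 1) + 1))
    (h4 : RN (yh + yl) = yh) (h3 : |(yh + yl) - y| < ε * |y|)
    (hc : (1 + (2 : ℝ) ^ (-(p : ℤ))) / (1 - ε - 2 ^ (p + 1) * ε) ≤ c)
    (htest : RN (yh + RN (yl * c)) = yh) : RN y = yh := by
  have hp1 : 1 ≤ p := by omega
  -- notation-free: U = ulp(yh) = 2^(e-p+1)
  have hU : (0 : ℝ) < (2 : ℝ) ^ (e - p + 1) := by positivity
  have h2e : (0 : ℝ) < (2 : ℝ) ^ e := by positivity
  have hyh0 : 0 < yh := lt_of_lt_of_le h2e he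
  have h2p : (0 : ℝ) < (2 : ℝ) ^ p := by positivity
  have hpp : (2 : ℝ) ^ (p + 1) = 2 * 2 ^ p := by rw [pow_succ]; ring
  have hpow_e1 : (2 : ℝ) ^ (e + 1) = 2 ^ p * (2 : ℝ) ^ (e - p + 1) := by
    rw [← zpow_natCast, ← zpow_add₀ (by norm_num)]; congr 1; ring
  have hpow_e : (2 : ℝ) ^ e = 2 ^ p * (2 : ℝ) ^ (e - p + 1) / 2 := by
    have : (2 : ℝ) ^ (e + 1) = 2 ^ e * 2 := zpow_add_one₀ (by norm_num) e
    rw [this] at hpow_e1; linarith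
  have hyhU : yh < 2 ^ p * (2 : ℝ) ^ (e - p + 1) := by rw [← hpow_e1]; exact he'
  -- ε : positive and small
  have hε1 : (2 ^ (p + 1) + 1) * ε < 1 := by
    rwa [lt_div_iff₀ (by positivity), mul_comm] at hε
  rw [hpp] at hε1
  have hεy : 0 < ε * |y| := lt_of_le_of_lt (abs_nonneg _) h3
  have hε0 : 0 < ε := by
    by_contra hle; push Not at hle
    have := mul_nonpos_of_nonpos_of_nonneg hle (abs_nonneg y)
    linarith
  have h2pε : 0 < 2 ^ p * ε := mul_pos h2p hε0
  have hA : 2 ^ p * ε < 1 - ε := by linarith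
  have hA' : 2 ^ p * ε < 1 / 2 := by linarith
  have hεlt : ε < 1 / 2 := by
    have h4le : (4 : ℝ) ≤ 2 * 2 ^ p := by
      have : (2 : ℝ) ≤ 2 ^ p := by
        calc (2 : ℝ) = 2 ^ 1 := by norm_num
          _ ≤ 2 ^ p := pow_le_pow_right₀ (by norm_num) hp1
      linarith
    have := mul_le_mul_of_nonneg_right h4le hε0.le
    linarith
  have hε_1 : 0 < 1 - ε := by linarith
  have hden : 0 < 1 - ε - 2 ^ (p + 1) * ε := by rw [hpp]; linarith
  have hApos : (0 : ℝ) < 1 + (2 : ℝ) ^ (-(p : ℤ)) := by positivity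
  have hc0 : 0 < c := lt_of_lt_of_le (div_pos hApos hden) hc
  -- "(3) and (4) imply that yh and y have the same sign": yh + yℓ > 0 and y > 0
  have hs : 0 < yh + yl := by
    by_contra hle; push Not at hle
    have := hRN.nonpos hle; rw [h4] at this; linarith
  have hy : 0 < y := by
    by_contra hle; push Not at hle
    rw [abs_of_nonpos hle] at h3
    have h' := (abs_lt.1 h3).2
    have := mul_nonpos_of_nonpos_of_nonneg hle hε_1.le
    nlinarith
  rw [abs_of_pos hy] at h3
  -- (6): |yh − y| < ε/(1−ε)·(yh + yℓ) + |yℓ|, in the form (1−ε)|yh − y| < ε (yh + yℓ) + (1−ε)|yℓ|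
  have h6 : (1 - ε) * |yh - y| < ε * (yh + yl) + (1 - ε) * |yl| := by
    have hylt : (1 - ε) * y < yh + yl := by have := (abs_lt.1 h3).1; linarith
    have htri : |yh - y| ≤ |yh + yl - y| + |yl| := by
      calc |yh - y| = |(yh + yl - y) - yl| := by ring_nf
        _ ≤ |yh + yl - y| + |yl| := abs_sub _ _
    have t1 := mul_le_mul_of_nonneg_left htri hε_1.le
    have t2 := mul_lt_mul_of_pos_left h3 hε_1
    have t3 := mul_lt_mul_of_pos_left hylt hε0
    nlinarith
  -- the magic constant: c·(1 − ε − 2^(p+1) ε) ≥ 1 + 2^(−p)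
  have hcden : 1 + (2 : ℝ) ^ (-(p : ℤ)) ≤ c * (1 - ε - 2 ^ (p + 1) * ε) := by
    rwa [div_le_iff₀ hden] at hc
  -- KEY STEP shared by Properties 4 and 7: from |yℓ·c| ≤ B·(1 + 2^-p) to |yℓ| ≤ B·(1 − ε − 2^(p+1) ε)
  have key : ∀ {B : ℝ}, |yl * c| ≤ B * (1 + (2 : ℝ) ^ (-(p : ℤ))) →
      |yl| ≤ B * (1 - ε - 2 ^ (p + 1) * ε) := by
    intro B hylc
    rw [abs_mul, abs_of_pos hc0] at hylc
    have t1 := mul_le_mul_of_nonneg_left hcden (abs_nonneg yl)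
    have t2 := mul_le_mul_of_nonneg_right hylc hden.le
    refine le_of_mul_le_mul_right ?_ hApos
    calc |yl| * (1 + (2 : ℝ) ^ (-(p : ℤ))) ≤ |yl| * (c * (1 - ε - 2 ^ (p + 1) * ε)) := t1
      _ = |yl| * c * (1 - ε - 2 ^ (p + 1) * ε) := by ring
      _ ≤ B * (1 + (2 : ℝ) ^ (-(p : ℤ))) * (1 - ε - 2 ^ (p + 1) * ε) := t2
      _ = B * (1 - ε - 2 ^ (p + 1) * ε) * (1 + (2 : ℝ) ^ (-(p : ℤ))) := by ring
  -- from |yℓ| ≤ (U/2)(1 − ε − 2^(p+1) ε) and (6) to |yh − y| < U/2   (Properties 2 and 4)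
  have prop24 : |yl| ≤ (2 : ℝ) ^ (e - p + 1) / 2 * (1 - ε - 2 ^ (p + 1) * ε) →
      |yh - y| < (2 : ℝ) ^ (e - p + 1) / 2 := by
    intro hyl
    rw [hpp] at hyl
    have t1 := mul_lt_mul_of_pos_left hyhU hε0
    have hyl' : |yl| + ε * yh ≤ (2 : ℝ) ^ (e - p + 1) / 2 * (1 - ε) := by linarith
    have t2 := mul_le_mul_of_nonneg_left (le_abs_self yl) hε0.le
    have h7 : (1 - ε) * |yh - y| < (1 - ε) * ((2 : ℝ) ^ (e - p + 1) / 2) := by linarith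
    exact lt_of_mul_lt_mul_left h7 hε_1.le
  have hU2 : (2 : ℝ) ^ (e - p + 1) / 2 = (2 : ℝ) ^ (e - p) := by
    rw [zpow_add_one₀ (by norm_num : (2 : ℝ) ≠ 0)]; ring
  rcases he.lt_or_eq with hne2 | heq2
  · ----------------------------------------------------------------- yh is not a power of two
    -- Property 3: |RN(yℓ c)| ≤ U/2, hence |yℓ c| ≤ (U/2)(1 + 2^-p)
    have hz : |RN (yl * c)| ≤ (2 : ℝ) ^ (e - p) := by
      rw [← hU2]; exact hRN.abs_le_half_ulp_of_test hp1 hyh hne2 he' htest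
    have hylc : |yl * c| ≤ (2 : ℝ) ^ (e - p + 1) / 2 * (1 + (2 : ℝ) ^ (-(p : ℤ))) := by
      rw [hU2]; exact hRN.abs_le_of_abs_rn_le_two_zpow hp1 hz
    exact hRN.rn_eq_of_abs_sub_lt_half_ulp hp1 hyh hne2 (prop24 (key hylc))
  · ----------------------------------------------------------------- yh = 2^e
    have hyh2 : yh = (2 : ℝ) ^ e := heq2.symm
    have htest' : RN ((2 : ℝ) ^ e + RN (yl * c)) = (2 : ℝ) ^ e := by rw [← hyh2]; exact htest
    rcases le_or_gt yh y with hyy | hyy <;> rcases le_or_gt 0 yl with hyl0 | hyl0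
    · -- (1) y ≥ yh, yℓ ≥ 0: as in Properties 2–4, using the upper neighbour only
      have hz0 : 0 ≤ RN (yl * c) := hRN.nonneg (mul_nonneg hyl0 hc0.le)
      have hz : RN (yl * c) ≤ (2 : ℝ) ^ (e - p + 1) / 2 := hRN.le_half_ulp_of_test_pow2 hp1 hz0 htest'
      have hz' : |RN (yl * c)| ≤ (2 : ℝ) ^ (e - p) := by rw [abs_of_nonneg hz0, ← hU2]; exact hz
      have hylc : |yl * c| ≤ (2 : ℝ) ^ (e - p + 1) / 2 * (1 + (2 : ℝ) ^ (-(p : ℤ))) := by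
        rw [hU2]; exact hRN.abs_le_of_abs_rn_le_two_zpow hp1 hz'
      have hdist := prop24 (key hylc)
      rw [abs_of_nonpos (by linarith)] at hdist
      rw [hyh2] at hyy ⊢
      exact hRN.rn_eq_two_zpow hp1 (by linarith) (by linarith)
    · -- (2) y ≥ yh, yℓ < 0: Property 1 (y is closer to yh than to yh + yℓ)
      have h1 : y - yh < ε * y := by have := (abs_lt.1 h3).1; linarith
      -- y − yh < ε y ⇒ (1−ε)(y − yh) < ε yh < (U/2)(1−ε)
      have h22 : yh * ε < (2 : ℝ) ^ (e - p + 1) / 2 * (1 - ε) := by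
        have := mul_lt_mul_of_pos_left hA (half_pos hU)
        rw [hyh2, hpow_e]; linarith
      have h7 : (1 - ε) * (y - yh) < (1 - ε) * ((2 : ℝ) ^ (e - p + 1) / 2) := by linarith
      have hy_lt := lt_of_mul_lt_mul_left h7 hε_1.le
      rw [hyh2] at hyy hy_lt ⊢
      exact hRN.rn_eq_two_zpow hp1 (by linarith) (by linarith)
    · -- (2) y < yh, yℓ ≥ 0: Property 1
      have h1 : yh - y < ε * y := by have := (abs_lt.1 h3).2; linarith
      have h21 : ε * y < ε * yh := mul_lt_mul_of_pos_left hyy hε0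
      have h22 : ε * yh < (2 : ℝ) ^ (e - p + 1) / 4 := by
        have := mul_lt_mul_of_pos_left hA' hU
        rw [hyh2, hpow_e]; linarith
      rw [hyh2] at hyy h1 h21 h22 ⊢
      exact hRN.rn_eq_two_zpow hp1 (by linarith) (by linarith)
    · -- (3) y < yh, yℓ < 0: Properties 5–7
      have hz0 : RN (yl * c) ≤ 0 := hRN.nonpos (by nlinarith)
      have hz : -RN (yl * c) ≤ (2 : ℝ) ^ (e - p + 1) / 4 :=
        hRN.neg_le_quarter_ulp_of_test_pow2 hz0 htest'
      have hU4 : (2 : ℝ) ^ (e - p + 1) / 4 = (2 : ℝ) ^ (e - p - 1) := by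
        rw [show e - p + 1 = (e - p - 1) + 1 + 1 by ring, zpow_add_one₀ (by norm_num : (2:ℝ) ≠ 0),
          zpow_add_one₀ (by norm_num : (2:ℝ) ≠ 0)]; ring
      -- Property 6: |yℓ c| ≤ (U/4)(1 + 2^-p)
      have hz' : |RN (yl * c)| ≤ (2 : ℝ) ^ (e - p - 1) := by rw [abs_of_nonpos hz0, ← hU4]; exact hz
      have hylc : |yl * c| ≤ (2 : ℝ) ^ (e - p + 1) / 4 * (1 + (2 : ℝ) ^ (-(p : ℤ))) := by
        rw [hU4]; exact hRN.abs_le_of_abs_rn_le_two_zpow hp1 hz'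
      have hyl := key hylc
      -- Property 5: with (6) and yℓ < 0 this gives yh − y < ¼ulp(yh)
      rw [abs_of_neg hyl0] at hyl h6
      rw [abs_of_pos (by linarith : 0 < yh - y)] at h6
      have hY : yh = 2 ^ (p + 1) * ((2 : ℝ) ^ (e - p + 1) / 4) := by rw [hyh2, hpow_e, hpp]; ring
      have hyl2 : -yl ≤ (2 : ℝ) ^ (e - p + 1) / 4 * (1 - ε) - ε * yh := by rw [hY]; linarith
      have t1 := mul_pos hε0 (neg_pos.2 hyl0)
      have h7 : (1 - ε) * (yh - y) < (1 - ε) * ((2 : ℝ) ^ (e - p + 1) / 4) := by linarith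
      have hdist := lt_of_mul_lt_mul_left h7 hε_1.le
      rw [hyh2] at hyy hdist ⊢
      exact hRN.rn_eq_two_zpow hp1 (by linarith) (by linarith)

/-- Theorem 2.1 for negative `yh` (the paper's "without loss of generality"), for rounding rules that
commute with negation (`RN(−t) = −RN(t)`: ties-to-even, ties-away). [cite: DedinechinEtAl2013, Theorem 2.1] -/
theorem ziv_rounding_test_of_neg (hp : 2 ≤ p) (hRN : IsRoundNearest p RN)
    (hsymm : ∀ t : ℝ, RN (-t) = -RN t) {y yh yl ε c : ℝ} {e : ℤ}
    (hyh : IsFloat p yh) (he : (2 : ℝ) ^ e ≤ -yh) (he' : -yh < (2 : ℝ) ^ (e + 1))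
    (hε : ε < 1 / (2 ^ (p + 1) + 1))
    (h4 : RN (yh + yl) = yh) (h3 : |(yh + yl) - y| < ε * |y|)
    (hc : (1 + (2 : ℝ) ^ (-(p : ℤ))) / (1 - ε - 2 ^ (p + 1) * ε) ≤ c)
    (htest : RN (yh + RN (yl * c)) = yh) : RN y = yh := by
  have h4' : RN (-yh + -yl) = -yh := by rw [show -yh + -yl = -(yh + yl) by ring, hsymm, h4]
  have h3' : |(-yh + -yl) - (-y)| < ε * |-y| := by
    rw [abs_neg, show -yh + -yl - -y = -((yh + yl) - y) by ring, abs_neg]; exact h3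
  have htest' : RN (-yh + RN (-yl * c)) = -yh := by
    rw [show -yl * c = -(yl * c) by ring, hsymm, show -yh + -RN (yl * c) = -(yh + RN (yl * c)) by ring,
      hsymm, htest]
  have := ziv_rounding_test hp hRN hyh.neg he he' hε h4' h3' hc htest'
  rw [hsymm] at this
  linarith

end Main

/-! ### A witness: round-to-nearest functions exist (the hypothesis `IsRoundNearest` is not vacuous) -/

section Witness

variable {p : ℕ}

/-- A concrete round-to-nearest into the precision-`p` floats (ties resolved upwards by `round`):
`0 ↦ 0`, and for `t ≠ 0` with `2^e ≤ |t| < 2^(e+1)` (`e = Int.log 2 |t|`), `t ↦ round(t/u)·u`,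
`u = 2^(e−p+1)`. [cite: DedinechinEtAl2013, §1.4] -/
noncomputable def roundNearest (p : ℕ) (t : ℝ) : ℝ :=
  if t = 0 then 0
  else (round (t / (2 : ℝ) ^ (Int.log 2 |t| - p + 1)) : ℝ) * (2 : ℝ) ^ (Int.log 2 |t| - p + 1)

/-- `roundNearest p` is a round-to-nearest into the precision-`p` floats (`p ≥ 1`).
[cite: DedinechinEtAl2013, §1.4] -/
theorem isRoundNearest_roundNearest (hp : 1 ≤ p) : IsRoundNearest p (roundNearest p) := by
  have hzero : IsFloat p 0 := ⟨0, 0, by simp, by simp⟩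
  -- the binade of t ≠ 0 and its ulp
  have binade : ∀ t : ℝ, t ≠ 0 → (2 : ℝ) ^ (Int.log 2 |t|) ≤ |t| ∧ |t| < (2 : ℝ) ^ (Int.log 2 |t| + 1) := by
    intro t ht
    have hta : 0 < |t| := abs_pos.2 ht
    constructor
    · exact_mod_cast Int.zpow_log_le_self (b := 2) (by norm_num) hta
    · exact_mod_cast Int.lt_zpow_succ_log_self (b := 2) (by norm_num) |t|
  constructor
  · intro t
    unfold roundNearest
    split_ifs with ht
    · exact hzero
    · obtain ⟨e, he_def⟩ : ∃ e : ℤ, Int.log 2 |t| = e := ⟨_, rfl⟩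
      obtain ⟨hge, hlt⟩ := binade t ht
      rw [he_def] at hge hlt ⊢
      have hu : (0 : ℝ) < (2 : ℝ) ^ (e - p + 1) := by positivity
      have hpow_e1 : (2 : ℝ) ^ (e + 1) = 2 ^ p * (2 : ℝ) ^ (e - p + 1) := by
        rw [← zpow_natCast, ← zpow_add₀ (by norm_num)]; congr 1; ring
      have hq : |t / (2 : ℝ) ^ (e - p + 1)| < 2 ^ p := by
        rw [abs_div, abs_of_pos hu, div_lt_iff₀ hu, ← hpow_e1]; exact hlt
      apply IsFloat.of_abs_le hp
      have h1 : |(round (t / (2 : ℝ) ^ (e - p + 1)) : ℝ)| ≤ |t / (2 : ℝ) ^ (e - p + 1)| + 1 / 2 := by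
        have h' := abs_sub_round (t / (2 : ℝ) ^ (e - p + 1))
        have h'' : |(round (t / (2 : ℝ) ^ (e - p + 1)) : ℝ)|
            ≤ |t / (2 : ℝ) ^ (e - p + 1)| + |t / (2 : ℝ) ^ (e - p + 1) - round (t / (2 : ℝ) ^ (e - p + 1))| := by
          calc |(round (t / (2 : ℝ) ^ (e - p + 1)) : ℝ)|
              = |t / (2 : ℝ) ^ (e - p + 1) - (t / (2 : ℝ) ^ (e - p + 1) - round (t / (2 : ℝ) ^ (e - p + 1)))| := by
                ring_nf
            _ ≤ _ := abs_sub _ _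
        linarith
      have h3 : |round (t / (2 : ℝ) ^ (e - p + 1))| < 2 ^ p + 1 := by
        have : (((|round (t / (2 : ℝ) ^ (e - p + 1))| : ℤ)) : ℝ) < ((2 ^ p + 1 : ℤ) : ℝ) := by
          rw [Int.cast_abs]; push_cast; linarith
        exact_mod_cast this
      exact Int.lt_add_one_iff.mp h3
  · intro t f hf
    unfold roundNearest
    split_ifs with ht
    · rw [ht, sub_zero, sub_zero, abs_zero]; exact abs_nonneg f
    · obtain ⟨e, he_def⟩ : ∃ e : ℤ, Int.log 2 |t| = e := ⟨_, rfl⟩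
      obtain ⟨hge, hlt⟩ := binade t ht
      rw [he_def] at hge hlt ⊢
      have hu : (0 : ℝ) < (2 : ℝ) ^ (e - p + 1) := by positivity
      have hpow_e : (2 : ℝ) ^ e = ((2 ^ (p - 1) : ℤ) : ℝ) * (2 : ℝ) ^ (e - p + 1) := by
        obtain ⟨p', rfl⟩ : ∃ p', p = p' + 1 := ⟨p - 1, by omega⟩
        push_cast; rw [← zpow_natCast, ← zpow_add₀ (by norm_num)]; congr 1; ring
      have htu : t / (2 : ℝ) ^ (e - p + 1) * (2 : ℝ) ^ (e - p + 1) = t := div_mul_cancel₀ t hu.ne'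
      -- the rounded value is at least as close to t as every integer multiple K·u
      have hint : ∀ K : ℤ, |(round (t / (2 : ℝ) ^ (e - p + 1)) : ℝ) * (2 : ℝ) ^ (e - p + 1) - t|
          ≤ |(K : ℝ) * (2 : ℝ) ^ (e - p + 1) - t| := by
        intro K
        have h1 : (round (t / (2 : ℝ) ^ (e - p + 1)) : ℝ) * (2 : ℝ) ^ (e - p + 1) - t
            = ((round (t / (2 : ℝ) ^ (e - p + 1)) : ℝ) - t / (2 : ℝ) ^ (e - p + 1)) * (2 : ℝ) ^ (e - p + 1) := by
          rw [sub_mul, htu]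
        have h2 : (K : ℝ) * (2 : ℝ) ^ (e - p + 1) - t
            = ((K : ℝ) - t / (2 : ℝ) ^ (e - p + 1)) * (2 : ℝ) ^ (e - p + 1) := by
          rw [sub_mul, htu]
        rw [h1, h2, abs_mul, abs_mul, abs_of_pos hu, abs_sub_comm ((round _ : ℤ) : ℝ), abs_sub_comm (K : ℝ)]
        exact mul_le_mul_of_nonneg_right (round_le _ K) hu.le
      rcases le_or_gt ((2 : ℝ) ^ e) |f| with hfe | hfe
      · -- |f| ≥ 2^e: f = K u
        obtain ⟨K, hK⟩ := hf.exists_int_mul_of_le hfe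
        rw [hK]; exact hint K
      · -- |f| < 2^e ≤ |t|: ±2^e (an integer multiple of u) lies between f and t
        have hf' := abs_lt.1 hfe
        rcases lt_or_gt_of_ne ht with htneg | htpos
        · rw [abs_of_neg htneg] at hge hlt
          have hK := hint (-(2 ^ (p - 1)))
          have hKu : ((-(2 ^ (p - 1)) : ℤ) : ℝ) * (2 : ℝ) ^ (e - p + 1) = -(2 : ℝ) ^ e := by
            rw [hpow_e]; push_cast; ring
          rw [hKu] at hK
          refine le_trans hK ?_
          rw [abs_of_nonneg (by linarith), abs_of_nonneg (by linarith)]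
          linarith
        · rw [abs_of_pos htpos] at hge hlt
          have hK := hint (2 ^ (p - 1))
          have hKu : ((2 ^ (p - 1) : ℤ) : ℝ) * (2 : ℝ) ^ (e - p + 1) = (2 : ℝ) ^ e := by rw [hpow_e]
          rw [hKu] at hK
          refine le_trans hK ?_
          rw [abs_of_nonpos (by linarith), abs_of_nonpos (by linarith)]
          linarith

end Witness

/-! ## Section 3 of [DedinechinEtAl2013]: additional results (Theorems 3.1 and 3.2), Ziv's strategy
(§1.2.1) and the ties-to-even rule (§1.1)

Appended 2026-08-20 (lit seat gen-4). Spacing lemmas (`IsFloat.add_ulp_le_of_lt`, `le_sub_ulp_of_lt`,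
`pred_two_zpow`, …), bracketing lemmas for any round-to-nearest (`le_rn_of_le`, `rn_le_of_le`,
`abs_rn_le_two_zpow`, `rn_eq_or_eq_of_consecutive`), the soundness of Ziv's strategy in the form the
libraries test it (`IsRoundNearest.rn_eq_of_rn_endpoints_eq`: both endpoints of an interval containing `y`
round to `v` ⇒ `RN y = v`, for EVERY round-to-nearest), the predicate `TiesToEven` (the IEEE rule the
paper assumes; used only by Theorem 3.1), Theorem 3.2 (`ziv_rounding_test_fma`, the fma form of the test
with the smaller constant `1/(1 − ε − 2^(p+1)ε)`) and Theorem 3.1 (`ziv_test_failure`: when the test fails,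
`yh` and `yc = RN(yh + RN(e·yℓ))` are consecutive floats bracketing `y`, so `RN(y) ∈ {yh, yc}`).
NOT here: §3.3 (subnormal `¼ulp(yh)`, bound (19)), §2.3/§4 experiments, Table I. -/

namespace IsFloat

variable {p : ℕ}

/-- SUCCESSOR SPACING: for a float `yh ≥ 2^e`, every float `f > yh` satisfies `f ≥ yh + 2^(e−p+1)`
(`yh` and `f` are both integer multiples of the ulp `2^(e−p+1)` of the binade).
[cite: DedinechinEtAl2013, §2.1.1] -/
theorem add_ulp_le_of_lt {yh f : ℝ} {e : ℤ} (hyh : IsFloat p yh) (hf : IsFloat p f)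
    (he : (2 : ℝ) ^ e ≤ yh) (hlt : yh < f) : yh + (2 : ℝ) ^ (e - p + 1) ≤ f := by
  have hu : (0 : ℝ) < (2 : ℝ) ^ (e - p + 1) := by positivity
  have h2e : (0 : ℝ) < (2 : ℝ) ^ e := by positivity
  obtain ⟨K, hK⟩ := hyh.exists_int_mul_of_le (e := e) (by rw [abs_of_pos (by linarith)]; exact he)
  obtain ⟨L, hL⟩ := hf.exists_int_mul_of_le (e := e) (by rw [abs_of_pos (by linarith)]; linarith)
  have hKL : K < L := by
    have : (K : ℝ) * (2 : ℝ) ^ (e - p + 1) < L * (2 : ℝ) ^ (e - p + 1) := by rw [← hK, ← hL]; exact hlt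
    exact_mod_cast lt_of_mul_lt_mul_right this hu.le
  have h' : ((K + 1 : ℤ) : ℝ) ≤ L := by exact_mod_cast hKL
  have hmul := mul_le_mul_of_nonneg_right h' hu.le
  rw [hK, hL]; push_cast at hmul ⊢; linarith

/-- PREDECESSOR SPACING (not a power of two): for a float `yh > 2^e`, every float `f < yh` satisfies
`f ≤ yh − 2^(e−p+1)`. [cite: DedinechinEtAl2013, §2.1.1] -/
theorem le_sub_ulp_of_lt (hp : 1 ≤ p) {yh f : ℝ} {e : ℤ} (hyh : IsFloat p yh) (hf : IsFloat p f)
    (he : (2 : ℝ) ^ e < yh) (hlt : f < yh) : f ≤ yh - (2 : ℝ) ^ (e - p + 1) := by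
  have h := IsRoundNearest.ulp_le_abs_sub hp hyh hf he hlt.ne
  rw [abs_of_neg (by linarith)] at h
  linarith

/-- A float of precision `p − 1` is a float of precision `p`. [cite: BrisebarreMuller2007, §1] -/
theorem of_pred {x : ℝ} (hx : IsFloat (p - 1) x) : IsFloat p x := by
  obtain ⟨M, E, hM, rfl⟩ := hx
  exact ⟨M, E, lt_of_lt_of_le hM (pow_le_pow_right₀ (by norm_num) (Nat.sub_le p 1)), rfl⟩

/-- The predecessor `2^e − 2^(e−p) = (2^p − 1)·2^(e−p)` of a power of two has an ODD integral
significand: it is not a float of precision `p − 1` (`p ≥ 1`). Used with the ties-to-even rule.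
[cite: DedinechinEtAl2013, §1.1] -/
theorem pred_two_zpow_not_isFloat_pred (hp : 1 ≤ p) (e : ℤ) :
    ¬ IsFloat (p - 1) ((2 : ℝ) ^ e - (2 : ℝ) ^ (e - p)) := by
  rintro ⟨M, E, hM, hME⟩
  -- (2^p - 1) · 2^(e-p) = M · 2^E
  have hN : (2 : ℝ) ^ e - (2 : ℝ) ^ (e - p) = (((2 : ℤ) ^ p - 1 : ℤ) : ℝ) * (2 : ℝ) ^ (e - p) := by
    push_cast
    rw [sub_mul, one_mul, ← zpow_natCast, ← zpow_add₀ (by norm_num : (2 : ℝ) ≠ 0)]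
    congr 2; ring
  rw [hN] at hME
  have hMabs : |M| < 2 ^ (p - 1) := hM
  rcases le_or_gt E (e - p) with hE | hE
  · -- E ≤ e - p: M = (2^p - 1)·2^(e-p-E), too big
    obtain ⟨d, hd⟩ : ∃ d : ℕ, e - p = E + d := ⟨(e - p - E).toNat, by omega⟩
    have hM' : (M : ℝ) = (((2 : ℤ) ^ p - 1) * 2 ^ d : ℤ) := by
      have h2E : (0 : ℝ) < (2 : ℝ) ^ E := by positivity
      have : (((2 : ℤ) ^ p - 1 : ℤ) : ℝ) * (2 : ℝ) ^ (e - p) = ((((2 : ℤ) ^ p - 1) * 2 ^ d : ℤ) : ℝ) * (2 : ℝ) ^ E := by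
        rw [hd, zpow_add₀ (by norm_num), zpow_natCast]; push_cast; ring
      rw [this] at hME
      exact_mod_cast (mul_right_cancel₀ h2E.ne' hME).symm
    have hMeq : M = ((2 : ℤ) ^ p - 1) * 2 ^ d := by exact_mod_cast hM'
    have h1 : (1 : ℤ) ≤ 2 ^ d := one_le_pow₀ (by norm_num)
    have h2 : (2 : ℤ) ^ (p - 1) ≤ 2 ^ p - 1 := by
      obtain ⟨p', rfl⟩ : ∃ p', p = p' + 1 := ⟨p - 1, by omega⟩
      rw [Nat.add_sub_cancel, pow_succ]
      have := one_le_pow₀ (M₀ := ℤ) (a := 2) (by norm_num) (n := p')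
      linarith
    have h3 : (2 : ℤ) ^ p - 1 ≤ M := by
      have h2p : (1 : ℤ) ≤ 2 ^ p := one_le_pow₀ (by norm_num)
      have h0 : 0 ≤ ((2 : ℤ) ^ p - 1) * (2 ^ d - 1) := mul_nonneg (by linarith) (by linarith)
      rw [hMeq]; nlinarith
    have := (abs_lt.1 hMabs).2
    omega
  · -- E > e - p: then 2^p - 1 = M · 2^(E - (e-p)) is even — contradiction
    obtain ⟨d, hd, hd1⟩ : ∃ d : ℕ, E = (e - p) + d ∧ 1 ≤ d := ⟨(E - (e - p)).toNat, by omega, by omega⟩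
    have hv : (0 : ℝ) < (2 : ℝ) ^ (e - p) := by positivity
    have : (((2 : ℤ) ^ p - 1 : ℤ) : ℝ) * (2 : ℝ) ^ (e - p) = ((M * 2 ^ d : ℤ) : ℝ) * (2 : ℝ) ^ (e - p) := by
      rw [hME, hd, zpow_add₀ (by norm_num), zpow_natCast]; push_cast; ring
    have hZ : (2 : ℤ) ^ p - 1 = M * 2 ^ d := by exact_mod_cast mul_right_cancel₀ hv.ne' this
    obtain ⟨d', rfl⟩ : ∃ d', d = d' + 1 := ⟨d - 1, by omega⟩
    have h2 : (2 : ℤ) ∣ (2 : ℤ) ^ p - 1 := by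
      rw [hZ, pow_succ]; exact ⟨M * 2 ^ d', by ring⟩
    have h2' : (2 : ℤ) ∣ (2 : ℤ) ^ p := dvd_pow_self 2 (by omega)
    have h1 : (2 : ℤ) ∣ 1 := by
      have := dvd_sub h2' h2
      rwa [show (2 : ℤ) ^ p - (2 ^ p - 1) = 1 by ring] at this
    omega

end IsFloat


namespace IsRoundNearest

variable {p : ℕ} {RN : ℝ → ℝ}

/-- A float `a ≤ t` stays below `RN t` (otherwise `a` would be closer to `t` than `RN t`).
[cite: DedinechinEtAl2013, §1.1] -/
theorem le_rn_of_le (h : IsRoundNearest p RN) {a t : ℝ} (ha : IsFloat p a) (hat : a ≤ t) :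
    a ≤ RN t := by
  by_contra hlt
  push Not at hlt
  have h1 := h.nearest t a ha
  rw [abs_of_nonpos (by linarith : RN t - t ≤ 0), abs_of_nonpos (by linarith : a - t ≤ 0)] at h1
  linarith

/-- A float `b ≥ t` stays above `RN t`. [cite: DedinechinEtAl2013, §1.1] -/
theorem rn_le_of_le (h : IsRoundNearest p RN) {b t : ℝ} (hb : IsFloat p b) (htb : t ≤ b) :
    RN t ≤ b := by
  by_contra hlt
  push Not at hlt
  have h1 := h.nearest t b hb
  rw [abs_of_nonneg (by linarith : 0 ≤ RN t - t), abs_of_nonneg (by linarith : 0 ≤ b - t)] at h1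
  linarith

/-- Floats are fixed by `RN`. [cite: DedinechinEtAl2013, §1.1] -/
theorem rn_eq_self (h : IsRoundNearest p RN) {f : ℝ} (hf : IsFloat p f) : RN f = f :=
  le_antisymm (h.rn_le_of_le hf le_rfl) (h.le_rn_of_le hf le_rfl)

/-- `|w| ≤ 2^k ⇒ |RN w| ≤ 2^k` (`2^k` is a float). [cite: DedinechinEtAl2013, §3.1] -/
theorem abs_rn_le_two_zpow (h : IsRoundNearest p RN) (hp : 1 ≤ p) {w : ℝ} {k : ℤ}
    (hw : |w| ≤ (2 : ℝ) ^ k) : |RN w| ≤ (2 : ℝ) ^ k := by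
  rw [abs_le] at hw ⊢
  exact ⟨h.le_rn_of_le (IsFloat.two_zpow hp k).neg hw.1, h.rn_le_of_le (IsFloat.two_zpow hp k) hw.2⟩

/-- If `y` lies between two CONSECUTIVE floats `a ≤ b` (no float strictly between them) then `RN y`
is `a` or `b` — the last sentence of Theorem 3.1. [cite: DedinechinEtAl2013, Theorem 3.1] -/
theorem rn_eq_or_eq_of_consecutive (h : IsRoundNearest p RN) {a b y : ℝ} (ha : IsFloat p a)
    (hb : IsFloat p b) (hgap : ∀ f : ℝ, IsFloat p f → a < f → f < b → False)
    (hay : a ≤ y) (hyb : y ≤ b) : RN y = a ∨ RN y = b := by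
  by_contra hne
  push Not at hne
  exact hgap (RN y) (h.isFloat y) (lt_of_le_of_ne (h.le_rn_of_le ha hay) (Ne.symm hne.1))
    (lt_of_le_of_ne (h.rn_le_of_le hb hyb) hne.2)

/-- **Ziv's strategy is sound** [Ziv 1991], as printed in §1.2.1: "If all elements of I₁ round to the
same floating-point number ŷ […] then, necessarily, RN(f(x)) = ŷ." In the form implementations test:
if the two ENDPOINTS of an interval `[a, b] ∋ y` round to the same float `v`, then `RN y = v`. This
holds for EVERY round-to-nearest function, whatever its tie-breaking rule (if `RN y = w ≠ v`, then `y`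
is at least as close to `w` as to `v`, which forces the endpoint on `w`'s side to BE `y`).
[cite: DedinechinEtAl2013, §1.2.1] -/
theorem rn_eq_of_rn_endpoints_eq (h : IsRoundNearest p RN) {a b y v : ℝ} (ha : RN a = v)
    (hb : RN b = v) (hay : a ≤ y) (hyb : y ≤ b) : RN y = v := by
  by_contra hne
  have hv : IsFloat p v := ha ▸ h.isFloat a
  have hw : IsFloat p (RN y) := h.isFloat y
  -- y is at least as close to w := RN y as to v
  have hyw := h.nearest y v hv
  rcases lt_or_gt_of_ne hne with hlt | hgt
  · -- w < v: compare at the endpoint a ≤ y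
    have hav := h.nearest a (RN y) hw
    rw [ha] at hav
    -- |w - y| ≤ |v - y| with w < v ⇒ y ≤ (v + w)/2; |v - a| ≤ |w - a| ⇒ a ≥ (v+w)/2; so a = y
    have h1 : y ≤ (v + RN y) / 2 := by
      rcases le_or_gt y (RN y) with hyw' | hyw'
      · linarith
      · rw [abs_of_neg (by linarith)] at hyw
        rcases le_or_gt y v with hyv | hyv
        · rw [abs_of_nonneg (by linarith)] at hyw; linarith
        · rw [abs_of_neg (by linarith)] at hyw; linarith
    have h2 : (v + RN y) / 2 ≤ a := by
      rcases le_or_gt v a with hva | hva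
      · linarith
      · rw [abs_of_pos (by linarith)] at hav
        rcases le_or_gt (RN y) a with hwa | hwa
        · rw [abs_of_nonpos (by linarith)] at hav; linarith
        · rw [abs_of_pos (by linarith)] at hav; linarith
    have hya : y = a := le_antisymm (by linarith) hay
    exact hne (by rw [hya, ha])
  · -- w > v: compare at the endpoint b ≥ y
    have hbv := h.nearest b (RN y) hw
    rw [hb] at hbv
    have h1 : (v + RN y) / 2 ≤ y := by
      rcases le_or_gt (RN y) y with hyw' | hyw'
      · linarith
      · rw [abs_of_pos (by linarith)] at hyw
        rcases le_or_gt v y with hyv | hyv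
        · rw [abs_of_nonpos (by linarith)] at hyw; linarith
        · rw [abs_of_pos (by linarith)] at hyw; linarith
    have h2 : b ≤ (v + RN y) / 2 := by
      rcases le_or_gt b v with hva | hva
      · linarith
      · rw [abs_of_neg (by linarith : v - b < 0)] at hbv
        rcases le_or_gt b (RN y) with hwa | hwa
        · rw [abs_of_nonneg (by linarith)] at hbv; linarith
        · rw [abs_of_neg (by linarith)] at hbv; linarith
    have hyb' : y = b := le_antisymm hyb (by linarith)
    exact hne (by rw [hyb', hb])

end IsRoundNearest

/-- The IEEE "round to nearest, TIES TO EVEN" rule (§1.1: "when t falls exactly halfway between two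
consecutive floating-point numbers, RN_p(t) will be the one of these two numbers whose integral
significand is even"), stated for a round-to-nearest `RN`: whenever some other float is exactly as
close to `t` as `RN t`, the chosen `RN t` has an even integral significand, i.e. is a float of
precision `p − 1`. [cite: DedinechinEtAl2013, §1.1] -/
def TiesToEven (p : ℕ) (RN : ℝ → ℝ) : Prop :=
  ∀ t f : ℝ, IsFloat p f → f ≠ RN t → |f - t| = |RN t - t| → IsFloat (p - 1) (RN t)

/-- Unfolding lemma for `TiesToEven`. [cite: DedinechinEtAl2013, §1.1] -/
theorem tiesToEven_iff {p : ℕ} {RN : ℝ → ℝ} : TiesToEven p RN ↔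
    ∀ t f : ℝ, IsFloat p f → f ≠ RN t → |f - t| = |RN t - t| → IsFloat (p - 1) (RN t) := Iff.rfl

/-- Under ties-to-even, the midpoint `2^e − ¼ulp = 2^e − 2^(e−p−1)` between the power of two `2^e`
(even significand `2^(p−1)`) and its predecessor `2^e − 2^(e−p)` (odd significand `2^p − 1`) rounds
to `2^e` — "this is a consequence of the round to nearest even rule if yh is a power of two"
(proof of Theorem 3.1). [cite: DedinechinEtAl2013, Theorem 3.1] -/
theorem IsRoundNearest.rn_two_zpow_sub_quarter_ulp {p : ℕ} {RN : ℝ → ℝ} (h : IsRoundNearest p RN)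
    (hTE : TiesToEven p RN) (hp : 1 ≤ p) (e : ℤ) :
    RN ((2 : ℝ) ^ e - (2 : ℝ) ^ (e - p - 1)) = (2 : ℝ) ^ e := by
  have hv : (0 : ℝ) < (2 : ℝ) ^ (e - p - 1) := by positivity
  have hq : (2 : ℝ) ^ (e - p) = 2 * (2 : ℝ) ^ (e - p - 1) := by
    rw [show e - p = (e - p - 1) + 1 by ring, zpow_add_one₀ (by norm_num : (2 : ℝ) ≠ 0)]; ring
  have hpred : IsFloat p ((2 : ℝ) ^ e - (2 : ℝ) ^ (e - p)) := by
    have h2 : (2 : ℝ) ^ e = ((2 ^ p : ℤ) : ℝ) * (2 : ℝ) ^ (e - p) := by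
      push_cast; rw [← zpow_natCast, ← zpow_add₀ (by norm_num)]; congr 1; ring
    have h1 : (1 : ℤ) ≤ 2 ^ p := one_le_pow₀ (by norm_num)
    refine ⟨2 ^ p - 1, e - p, ?_, ?_⟩
    · rw [abs_of_nonneg (by linarith)]; linarith
    · rw [h2]; push_cast; ring
  have h2e : IsFloat p ((2 : ℝ) ^ e) := IsFloat.two_zpow hp e
  -- RN of the midpoint is one of the two neighbours
  have hay : (2 : ℝ) ^ e - (2 : ℝ) ^ (e - p) ≤ (2 : ℝ) ^ e - (2 : ℝ) ^ (e - p - 1) := by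
    rw [hq]; linarith
  have hyb : (2 : ℝ) ^ e - (2 : ℝ) ^ (e - p - 1) ≤ (2 : ℝ) ^ e := by linarith
  have hor := h.rn_eq_or_eq_of_consecutive hpred h2e
    (fun f hf h1 h2 => by linarith [hf.le_sub_of_lt hp h2]) hay hyb
  rcases hor with hlo | hhi
  · -- RN picked the odd neighbour although 2^e is equidistant: contradiction with ties-to-even
    exfalso
    have hdist : |(2 : ℝ) ^ e - ((2 : ℝ) ^ e - (2 : ℝ) ^ (e - p - 1))|
        = |RN ((2 : ℝ) ^ e - (2 : ℝ) ^ (e - p - 1)) - ((2 : ℝ) ^ e - (2 : ℝ) ^ (e - p - 1))| := by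
      rw [hlo, hq]
      rw [show (2 : ℝ) ^ e - ((2 : ℝ) ^ e - (2 : ℝ) ^ (e - p - 1)) = (2 : ℝ) ^ (e - p - 1) by ring,
        show (2 : ℝ) ^ e - 2 * (2 : ℝ) ^ (e - p - 1) - ((2 : ℝ) ^ e - (2 : ℝ) ^ (e - p - 1))
          = -((2 : ℝ) ^ (e - p - 1)) by ring, abs_neg]
    have hne : (2 : ℝ) ^ e ≠ RN ((2 : ℝ) ^ e - (2 : ℝ) ^ (e - p - 1)) := by
      rw [hlo, hq]; linarith
    have := hTE _ _ h2e hne hdist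
    rw [hlo] at this
    exact IsFloat.pred_two_zpow_not_isFloat_pred hp e this
  · exact hhi


/-! ### §3.2 — the test with an fma: Theorem 3.2 -/

section Fma

variable {p : ℕ} {RN : ℝ → ℝ}

/-- **Theorem 3.2 of [DedinechinEtAl2013] (Ziv's rounding test with an fma instruction), case
`yh > 0`.** "Assume that `yh` is a normal floating-point number and that `ε` is less than
`1/(2^(p+1) + 1)`. Also assume that `yh = RN(yh + yℓ)` and `|(yh + yℓ) − y| < ε·|y|`. If
`e ≥ 1/(1 − ε − 2^(p+1)ε)` then `yh = RN(yh + yℓ·e)` implies `yh = RN(y)`." Here the product `yℓ·e`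
enters the final rounding EXACTLY (one rounding `RN(yh + yℓ·e)` = the fma), which is why the factor
`(1 + 2^(−p))` of Theorem 2.1 disappears ("compared to Property 3, we get rid of the term (1+2^−p)").
Same model as `ziv_rounding_test` (precision `p ≥ 2`, unbounded exponents — so "yh normal" is
automatic —, ANY round-to-nearest `RN`); the proof is the paper's "very similar" adaptation of
Properties 1–7 with `RN(yℓ·e)` replaced by `yℓ·e`. [cite: DedinechinEtAl2013, Theorem 3.2] -/
theorem ziv_rounding_test_fma (hp : 2 ≤ p) (hRN : IsRoundNearest p RN) {y yh yl ε c : ℝ} {e : ℤ}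
    (hyh : IsFloat p yh) (he : (2 : ℝ) ^ e ≤ yh) (he' : yh < (2 : ℝ) ^ (e + 1))
    (hε : ε < 1 / (2 ^ (p + 1) + 1))
    (h4 : RN (yh + yl) = yh) (h3 : |(yh + yl) - y| < ε * |y|)
    (hc : 1 / (1 - ε - 2 ^ (p + 1) * ε) ≤ c)
    (htest : RN (yh + yl * c) = yh) : RN y = yh := by
  have hp1 : 1 ≤ p := by omega
  have hU : (0 : ℝ) < (2 : ℝ) ^ (e - p + 1) := by positivity
  have h2e : (0 : ℝ) < (2 : ℝ) ^ e := by positivity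
  have hyh0 : 0 < yh := lt_of_lt_of_le h2e he
  have h2p : (0 : ℝ) < (2 : ℝ) ^ p := by positivity
  have hpp : (2 : ℝ) ^ (p + 1) = 2 * 2 ^ p := by rw [pow_succ]; ring
  have hpow_e1 : (2 : ℝ) ^ (e + 1) = 2 ^ p * (2 : ℝ) ^ (e - p + 1) := by
    rw [← zpow_natCast, ← zpow_add₀ (by norm_num)]; congr 1; ring
  have hpow_e : (2 : ℝ) ^ e = 2 ^ p * (2 : ℝ) ^ (e - p + 1) / 2 := by
    have : (2 : ℝ) ^ (e + 1) = 2 ^ e * 2 := zpow_add_one₀ (by norm_num) e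
    rw [this] at hpow_e1; linarith
  have hyhU : yh < 2 ^ p * (2 : ℝ) ^ (e - p + 1) := by rw [← hpow_e1]; exact he'
  -- ε : positive and small
  have hε1 : (2 ^ (p + 1) + 1) * ε < 1 := by
    rwa [lt_div_iff₀ (by positivity), mul_comm] at hε
  rw [hpp] at hε1
  have hεy : 0 < ε * |y| := lt_of_le_of_lt (abs_nonneg _) h3
  have hε0 : 0 < ε := by
    by_contra hle; push Not at hle
    have := mul_nonpos_of_nonpos_of_nonneg hle (abs_nonneg y)
    linarith
  have h2pε : 0 < 2 ^ p * ε := mul_pos h2p hε0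
  have hA : 2 ^ p * ε < 1 - ε := by linarith
  have hA' : 2 ^ p * ε < 1 / 2 := by linarith
  have hεlt : ε < 1 / 2 := by
    have h4le : (4 : ℝ) ≤ 2 * 2 ^ p := by
      have : (2 : ℝ) ≤ 2 ^ p := by
        calc (2 : ℝ) = 2 ^ 1 := by norm_num
          _ ≤ 2 ^ p := pow_le_pow_right₀ (by norm_num) hp1
      linarith
    have := mul_le_mul_of_nonneg_right h4le hε0.le
    linarith
  have hε_1 : 0 < 1 - ε := by linarith
  have hden : 0 < 1 - ε - 2 ^ (p + 1) * ε := by rw [hpp]; linarith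
  have hc0 : 0 < c := lt_of_lt_of_le (div_pos one_pos hden) hc
  -- "(3) and (4) imply that yh and y have the same sign": yh + yℓ > 0 and y > 0
  have hs : 0 < yh + yl := by
    by_contra hle; push Not at hle
    have := hRN.nonpos hle; rw [h4] at this; linarith
  have hy : 0 < y := by
    by_contra hle; push Not at hle
    rw [abs_of_nonpos hle] at h3
    have h' := (abs_lt.1 h3).2
    have := mul_nonpos_of_nonpos_of_nonneg hle hε_1.le
    nlinarith
  rw [abs_of_pos hy] at h3
  -- (6): (1−ε)|yh − y| < ε (yh + yℓ) + (1−ε)|yℓ|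
  have h6 : (1 - ε) * |yh - y| < ε * (yh + yl) + (1 - ε) * |yl| := by
    have hylt : (1 - ε) * y < yh + yl := by have := (abs_lt.1 h3).1; linarith
    have htri : |yh - y| ≤ |yh + yl - y| + |yl| := by
      calc |yh - y| = |(yh + yl - y) - yl| := by ring_nf
        _ ≤ |yh + yl - y| + |yl| := abs_sub _ _
    have t1 := mul_le_mul_of_nonneg_left htri hε_1.le
    have t2 := mul_lt_mul_of_pos_left h3 hε_1
    have t3 := mul_lt_mul_of_pos_left hylt hε0
    nlinarith
  -- the constant: c·(1 − ε − 2^(p+1) ε) ≥ 1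
  have hcden : 1 ≤ c * (1 - ε - 2 ^ (p + 1) * ε) := by
    rwa [div_le_iff₀ hden] at hc
  -- KEY STEP (the fma form of Properties 4 and 7): from |yℓ·c| ≤ B to |yℓ| ≤ B·(1 − ε − 2^(p+1) ε)
  have key : ∀ {B : ℝ}, |yl * c| ≤ B → |yl| ≤ B * (1 - ε - 2 ^ (p + 1) * ε) := by
    intro B hylc
    rw [abs_mul, abs_of_pos hc0] at hylc
    have t1 := mul_le_mul_of_nonneg_left hcden (abs_nonneg yl)
    have t2 := mul_le_mul_of_nonneg_right hylc hden.le
    calc |yl| = |yl| * 1 := by ring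
      _ ≤ |yl| * (c * (1 - ε - 2 ^ (p + 1) * ε)) := t1
      _ = |yl| * c * (1 - ε - 2 ^ (p + 1) * ε) := by ring
      _ ≤ B * (1 - ε - 2 ^ (p + 1) * ε) := t2
  -- from |yℓ| ≤ (U/2)(1 − ε − 2^(p+1) ε) and (6) to |yh − y| < U/2   (Properties 2 and 4)
  have prop24 : |yl| ≤ (2 : ℝ) ^ (e - p + 1) / 2 * (1 - ε - 2 ^ (p + 1) * ε) →
      |yh - y| < (2 : ℝ) ^ (e - p + 1) / 2 := by
    intro hyl
    rw [hpp] at hyl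
    have t1 := mul_lt_mul_of_pos_left hyhU hε0
    have hyl' : |yl| + ε * yh ≤ (2 : ℝ) ^ (e - p + 1) / 2 * (1 - ε) := by linarith
    have t2 := mul_le_mul_of_nonneg_left (le_abs_self yl) hε0.le
    have h7 : (1 - ε) * |yh - y| < (1 - ε) * ((2 : ℝ) ^ (e - p + 1) / 2) := by linarith
    exact lt_of_mul_lt_mul_left h7 hε_1.le
  have hU2 : (2 : ℝ) ^ (e - p + 1) / 2 = (2 : ℝ) ^ (e - p) := by
    rw [zpow_add_one₀ (by norm_num : (2 : ℝ) ≠ 0)]; ring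
  rcases he.lt_or_eq with hne2 | heq2
  · ----------------------------------------------------------------- yh is not a power of two
    -- Property 3 (fma form): yh = RN(yh + yℓ c) ⇒ |yℓ c| ≤ U/2
    have hylc : |yl * c| ≤ (2 : ℝ) ^ (e - p + 1) / 2 :=
      hRN.abs_le_half_ulp_of_test hp1 hyh hne2 he' htest
    exact hRN.rn_eq_of_abs_sub_lt_half_ulp hp1 hyh hne2 (prop24 (key hylc))
  · ----------------------------------------------------------------- yh = 2^e
    have hyh2 : yh = (2 : ℝ) ^ e := heq2.symm
    have htest' : RN ((2 : ℝ) ^ e + yl * c) = (2 : ℝ) ^ e := by rw [← hyh2]; exact htest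
    rcases le_or_gt yh y with hyy | hyy <;> rcases le_or_gt 0 yl with hyl0 | hyl0
    · -- (1) y ≥ yh, yℓ ≥ 0
      have hz0 : 0 ≤ yl * c := mul_nonneg hyl0 hc0.le
      have hz : yl * c ≤ (2 : ℝ) ^ (e - p + 1) / 2 := hRN.le_half_ulp_of_test_pow2 hp1 hz0 htest'
      have hylc : |yl * c| ≤ (2 : ℝ) ^ (e - p + 1) / 2 := by rw [abs_of_nonneg hz0]; exact hz
      have hdist := prop24 (key hylc)
      rw [abs_of_nonpos (by linarith)] at hdist
      rw [hyh2] at hyy ⊢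
      exact hRN.rn_eq_two_zpow hp1 (by linarith) (by linarith)
    · -- (2) y ≥ yh, yℓ < 0: Property 1
      have h1 : y - yh < ε * y := by have := (abs_lt.1 h3).1; linarith
      have h22 : yh * ε < (2 : ℝ) ^ (e - p + 1) / 2 * (1 - ε) := by
        have := mul_lt_mul_of_pos_left hA (half_pos hU)
        rw [hyh2, hpow_e]; linarith
      have h7 : (1 - ε) * (y - yh) < (1 - ε) * ((2 : ℝ) ^ (e - p + 1) / 2) := by linarith
      have hy_lt := lt_of_mul_lt_mul_left h7 hε_1.le
      rw [hyh2] at hyy hy_lt ⊢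
      exact hRN.rn_eq_two_zpow hp1 (by linarith) (by linarith)
    · -- (2) y < yh, yℓ ≥ 0: Property 1
      have h1 : yh - y < ε * y := by have := (abs_lt.1 h3).2; linarith
      have h21 : ε * y < ε * yh := mul_lt_mul_of_pos_left hyy hε0
      have h22 : ε * yh < (2 : ℝ) ^ (e - p + 1) / 4 := by
        have := mul_lt_mul_of_pos_left hA' hU
        rw [hyh2, hpow_e]; linarith
      rw [hyh2] at hyy h1 h21 h22 ⊢
      exact hRN.rn_eq_two_zpow hp1 (by linarith) (by linarith)
    · -- (3) y < yh, yℓ < 0: Properties 5–7 (fma form)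
      have hz0 : yl * c ≤ 0 := by nlinarith
      have hz : -(yl * c) ≤ (2 : ℝ) ^ (e - p + 1) / 4 :=
        hRN.neg_le_quarter_ulp_of_test_pow2 hz0 htest'
      have hylc : |yl * c| ≤ (2 : ℝ) ^ (e - p + 1) / 4 := by rw [abs_of_nonpos hz0]; exact hz
      have hyl := key hylc
      -- Property 5: with (6) and yℓ < 0 this gives yh − y < ¼ulp(yh)
      rw [abs_of_neg hyl0] at hyl h6
      rw [abs_of_pos (by linarith : 0 < yh - y)] at h6
      have hY : yh = 2 ^ (p + 1) * ((2 : ℝ) ^ (e - p + 1) / 4) := by rw [hyh2, hpow_e, hpp]; ring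
      have hyl2 : -yl ≤ (2 : ℝ) ^ (e - p + 1) / 4 * (1 - ε) - ε * yh := by rw [hY]; linarith
      have t1 := mul_pos hε0 (neg_pos.2 hyl0)
      have h7 : (1 - ε) * (yh - y) < (1 - ε) * ((2 : ℝ) ^ (e - p + 1) / 4) := by linarith
      have hdist := lt_of_mul_lt_mul_left h7 hε_1.le
      rw [hyh2] at hyy hdist ⊢
      exact hRN.rn_eq_two_zpow hp1 (by linarith) (by linarith)

/-- Theorem 3.2 for negative `yh`, for rounding rules with `RN(−t) = −RN(t)`.
[cite: DedinechinEtAl2013, Theorem 3.2] -/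
theorem ziv_rounding_test_fma_of_neg (hp : 2 ≤ p) (hRN : IsRoundNearest p RN)
    (hsymm : ∀ t : ℝ, RN (-t) = -RN t) {y yh yl ε c : ℝ} {e : ℤ}
    (hyh : IsFloat p yh) (he : (2 : ℝ) ^ e ≤ -yh) (he' : -yh < (2 : ℝ) ^ (e + 1))
    (hε : ε < 1 / (2 ^ (p + 1) + 1))
    (h4 : RN (yh + yl) = yh) (h3 : |(yh + yl) - y| < ε * |y|)
    (hc : 1 / (1 - ε - 2 ^ (p + 1) * ε) ≤ c)
    (htest : RN (yh + yl * c) = yh) : RN y = yh := by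
  have h4' : RN (-yh + -yl) = -yh := by rw [show -yh + -yl = -(yh + yl) by ring, hsymm, h4]
  have h3' : |(-yh + -yl) - (-y)| < ε * |-y| := by
    rw [abs_neg, show -yh + -yl - -y = -((yh + yl) - y) by ring, abs_neg]; exact h3
  have htest' : RN (-yh + -yl * c) = -yh := by
    rw [show -yh + -yl * c = -(yh + yl * c) by ring, hsymm, htest]
  have := ziv_rounding_test_fma hp hRN hyh.neg he he' hε h4' h3' hc htest'
  rw [hsymm] at this
  linarith

end Fma


/-! ### §3.1 — when the test fails, it gives information anyway: Theorem 3.1 -/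

section Failure

variable {p : ℕ} {RN : ℝ → ℝ}

/-- The predecessor `2^e − 2^(e−p) = (2^p − 1)·2^(e−p)` of a power of two is a float.
[cite: DedinechinEtAl2013, §2.1.2] -/
theorem IsFloat.pred_two_zpow (e : ℤ) : IsFloat p ((2 : ℝ) ^ e - (2 : ℝ) ^ (e - p)) := by
  have h2 : (2 : ℝ) ^ e = ((2 ^ p : ℤ) : ℝ) * (2 : ℝ) ^ (e - p) := by
    push_cast; rw [← zpow_natCast, ← zpow_add₀ (by norm_num)]; congr 1; ring
  have h1 : (1 : ℤ) ≤ 2 ^ p := one_le_pow₀ (by norm_num)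
  refine ⟨2 ^ p - 1, e - p, ?_, ?_⟩
  · rw [abs_of_nonneg (by linarith)]; linarith
  · rw [h2]; push_cast; ring

/-- "Elementary manipulation shows that `(1 + 2^(−p))/(1 − ε − 2^(p+1)ε) < 2`, which implies `e ≤ 2`"
(proof of Theorem 3.1; `p ≥ 2`, `0 ≤ ε < 1/(2^(p+3) + 9)`): the magic constant of Theorem 2.1 is
below `2`, hence so is its rounding up `RU(·)` to a float (`2` is a float) — the only property of the
chosen `e` that the proof of Theorem 3.1 uses. [cite: DedinechinEtAl2013, Theorem 3.1] -/
theorem magic_constant_lt_two (hp : 2 ≤ p) {ε : ℝ} (hε0 : 0 ≤ ε) (hε : ε < 1 / (2 ^ (p + 3) + 9)) :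
    (1 + (2 : ℝ) ^ (-(p : ℤ))) / (1 - ε - 2 ^ (p + 1) * ε) < 2 := by
  have hX : (4 : ℝ) ≤ 2 ^ p := by
    calc (4 : ℝ) = 2 ^ 2 := by norm_num
      _ ≤ 2 ^ p := pow_le_pow_right₀ (by norm_num) hp
  have hε1 : (2 ^ (p + 3) + 9) * ε < 1 := by
    rwa [lt_div_iff₀ (by positivity), mul_comm] at hε
  have h8 : (2 : ℝ) ^ (p + 3) = 8 * 2 ^ p := by rw [pow_add]; norm_num; ring
  have h2 : (2 : ℝ) ^ (p + 1) = 2 * 2 ^ p := by rw [pow_succ]; ring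
  rw [h8] at hε1
  have hinv : (2 : ℝ) ^ (-(p : ℤ)) * 2 ^ p = 1 := by
    rw [← zpow_natCast, ← zpow_add₀ (by norm_num)]; simp
  have hden : 0 < 1 - ε - 2 ^ (p + 1) * ε := by rw [h2]; nlinarith
  rw [div_lt_iff₀ hden, h2]
  -- multiply the goal by 2^p > 0: (2^p + 1) < 2·2^p·(1 − ε − 2·2^p ε)
  have h2p : (0 : ℝ) < 2 ^ p := by positivity
  have key : (2 : ℝ) ^ p + 1 < 2 * 2 ^ p * (1 - ε - 2 * 2 ^ p * ε) := by nlinarith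
  have e1 : (1 + (2 : ℝ) ^ (-(p : ℤ))) * 2 ^ p = 2 ^ p + 1 := by rw [add_mul, hinv, one_mul]
  by_contra hle
  push Not at hle
  have := mul_le_mul_of_nonneg_right hle h2p.le
  rw [e1] at this
  nlinarith

/-- **Theorem 3.1 of [DedinechinEtAl2013] ("when the test fails, it gives us information anyway"),
case `yh > 0`.** Precision `p ≥ 2`; `RN` a round-to-nearest, TIES TO EVEN (the paper's standing
assumption, used in this proof: "this is a consequence of the round to nearest even rule if `yh` is a
power of two"); `ε < 1/(2^(p+3) + 9)`; (13) `yh + yℓ = y(1 + α)`, `|α| ≤ ε` (here: `|(yh + yℓ) − y| ≤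
ε|y|`) and `yh = RN(yh + yℓ)`; the constant: the paper takes `e = RU((1 + 2^(−p))/(1 − ε − 2^(p+1)ε))`
and uses of it only "`e ≤ 2`" (`magic_constant_lt_two`) — we assume `0 ≤ e ≤ 2`. CONCLUSION, when the
test fails (`yc := RN(yh + RN(e·yℓ)) ≠ yh`): "the two numbers `yh` and `yc` are consecutive
floating-point numbers [no float lies strictly between them], and `y` is between them, which implies
that `RN(y)` is either `yh` or `yc`." The proof follows the paper: `|RN(e yℓ)| ≤ ulp(yh)` (`≤ ½ulp` for
`yh = 2^e`, `yℓ < 0`) so `yc ∈ {yh⁻, yh, yh⁺}`; `yc ≠ yh` forces `|yℓ| ≥ ⅛ulp(yh)`, which dominates the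
approximation error `|α|y < ⅛ulp(yh)` (this is where `ε < 1/(2^(p+3)+9)` enters), so `y − yh` has the
sign of `yℓ` and `|y − yh| < |yℓ| + ⅛ulp`. [cite: DedinechinEtAl2013, Theorem 3.1] -/
theorem ziv_test_failure (hp : 2 ≤ p) (hRN : IsRoundNearest p RN) (hTE : TiesToEven p RN)
    {y yh yl ε c yc : ℝ} {e : ℤ}
    (hyh : IsFloat p yh) (he : (2 : ℝ) ^ e ≤ yh) (he' : yh < (2 : ℝ) ^ (e + 1))
    (hε : ε < 1 / (2 ^ (p + 3) + 9))
    (h13 : |(yh + yl) - y| ≤ ε * |y|) (h4 : RN (yh + yl) = yh)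
    (hc0 : 0 ≤ c) (hc2 : c ≤ 2)
    (hyc : RN (yh + RN (yl * c)) = yc) (hfail : yc ≠ yh) :
    IsFloat p yc ∧ (∀ f : ℝ, IsFloat p f → min yh yc < f → f < max yh yc → False)
      ∧ min yh yc ≤ y ∧ y ≤ max yh yc ∧ (RN y = yh ∨ RN y = yc) := by
  have hp1 : 1 ≤ p := by omega
  have hU : (0 : ℝ) < (2 : ℝ) ^ (e - p + 1) := by positivity
  have h2e : (0 : ℝ) < (2 : ℝ) ^ e := by positivity
  have hyh0 : 0 < yh := lt_of_lt_of_le h2e he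
  have h2p : (0 : ℝ) < (2 : ℝ) ^ p := by positivity
  have hpow_e1 : (2 : ℝ) ^ (e + 1) = 2 ^ p * (2 : ℝ) ^ (e - p + 1) := by
    rw [← zpow_natCast, ← zpow_add₀ (by norm_num)]; congr 1; ring
  have hpow_e : (2 : ℝ) ^ e = 2 ^ p * (2 : ℝ) ^ (e - p + 1) / 2 := by
    have : (2 : ℝ) ^ (e + 1) = 2 ^ e * 2 := zpow_add_one₀ (by norm_num) e
    rw [this] at hpow_e1; linarith
  have hU2 : (2 : ℝ) ^ (e - p + 1) / 2 = (2 : ℝ) ^ (e - p) := by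
    rw [zpow_add_one₀ (by norm_num : (2 : ℝ) ≠ 0)]; ring
  have hU4 : (2 : ℝ) ^ (e - p + 1) / 4 = (2 : ℝ) ^ (e - p - 1) := by
    rw [show e - p + 1 = (e - p - 1) + 1 + 1 by ring, zpow_add_one₀ (by norm_num : (2:ℝ) ≠ 0),
      zpow_add_one₀ (by norm_num : (2:ℝ) ≠ 0)]; ring
  have hyhU : yh < 2 ^ p * (2 : ℝ) ^ (e - p + 1) := by rw [← hpow_e1]; exact he'
  have hyc_fl : IsFloat p yc := hyc ▸ hRN.isFloat _
  -- ε: (2^(p+3) + 9) ε < 1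
  have hε1 : (2 ^ (p + 3) + 9) * ε < 1 := by
    rwa [lt_div_iff₀ (by positivity), mul_comm] at hε
  have h8 : (2 : ℝ) ^ (p + 3) = 8 * 2 ^ p := by rw [pow_add]; norm_num; ring
  rw [h8] at hε1
  -- signs: yh + yℓ > 0, y > 0, ε ≥ 0
  have hs : 0 < yh + yl := by
    by_contra hle; push Not at hle
    have := hRN.nonpos hle; rw [h4] at this; linarith
  have hy0 : y ≠ 0 := by
    rintro rfl
    rw [abs_zero, mul_zero, sub_zero] at h13
    have := abs_nonpos_iff.1 h13
    linarith
  have hε0 : 0 ≤ ε := by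
    by_contra hlt; push Not at hlt
    have := mul_neg_of_neg_of_pos hlt (abs_pos.2 hy0)
    linarith [abs_nonneg ((yh + yl) - y)]
  have hεlt1 : ε < 1 := by
    have : (1 : ℝ) * ε ≤ (8 * 2 ^ p + 9) * ε := mul_le_mul_of_nonneg_right (by linarith) hε0
    linarith
  have hy : 0 < y := by
    rcases lt_or_gt_of_ne hy0 with hneg | hpos
    · exfalso
      rw [abs_of_neg hneg] at h13
      have h' := (abs_le.1 h13).2
      have : y * (1 - ε) < 0 := mul_neg_of_neg_of_pos hneg (by linarith)
      linarith
    · exact hpos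
  rw [abs_of_pos hy] at h13
  -- |yℓ| ≤ ½ulp(yh) from (4), in all cases
  have hylU : |yl| ≤ (2 : ℝ) ^ (e - p + 1) / 2 := by
    rcases he.lt_or_eq with hne2 | heq2
    · exact hRN.abs_le_half_ulp_of_test hp1 hyh hne2 he' h4
    · have h4' : RN ((2 : ℝ) ^ e + yl) = (2 : ℝ) ^ e := by rw [heq2]; exact h4
      rcases le_or_gt 0 yl with hyl0 | hyl0
      · rw [abs_of_nonneg hyl0]; exact hRN.le_half_ulp_of_test_pow2 hp1 hyl0 h4'
      · rw [abs_of_neg hyl0]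
        have := hRN.neg_le_quarter_ulp_of_test_pow2 hyl0.le h4'
        linarith
  -- the approximation error is below ⅛ulp(yh): ε y < U/8
  have hεy : ε * y < (2 : ℝ) ^ (e - p + 1) / 8 := by
    have hy1 : y * (1 - ε) ≤ yh + yl := by have := (abs_le.1 h13).1; linarith
    have hs2 : yh + yl < (2 ^ p + 1 / 2) * (2 : ℝ) ^ (e - p + 1) := by
      have := le_abs_self yl; linarith
    rcases hε0.eq_or_lt with hz | hεpos
    · rw [← hz, zero_mul]; positivity
    · have t1 : ε * y * (1 - ε) < ε * ((2 ^ p + 1 / 2) * (2 : ℝ) ^ (e - p + 1)) := by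
        have := mul_lt_mul_of_pos_left (lt_of_le_of_lt hy1 hs2) hεpos; linarith
      have t2 : ε * ((2 ^ p + 1 / 2) * (2 : ℝ) ^ (e - p + 1)) ≤ (1 - ε) * ((2 : ℝ) ^ (e - p + 1) / 8) := by
        have h' : 8 * ε * (2 ^ p + 1 / 2) ≤ 1 - ε := by linarith
        have := mul_le_mul_of_nonneg_right h' hU.le
        linarith
      have t3 : ε * y * (1 - ε) < ((2 : ℝ) ^ (e - p + 1) / 8) * (1 - ε) := by linarith
      exact lt_of_mul_lt_mul_right t3 (by linarith)
  have hα : |yh + yl - y| ≤ ε * y := h13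
  -- z := RN(yℓ·e)
  obtain ⟨z, hz⟩ : ∃ z, RN (yl * c) = z := ⟨_, rfl⟩
  rw [hz] at hyc
  have hylc : |yl * c| ≤ 2 * |yl| := by
    rw [abs_mul, abs_of_nonneg hc0]
    have := mul_le_mul_of_nonneg_left hc2 (abs_nonneg yl)
    linarith
  -- "yc ≠ yh forces |yℓ| ≥ ⅛ulp": if |yℓ| < U/8 then |z| ≤ U/4
  have hsmall : |yl| < (2 : ℝ) ^ (e - p + 1) / 8 → |z| ≤ (2 : ℝ) ^ (e - p + 1) / 4 := by
    intro hlt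
    rw [hU4, ← hz]
    exact hRN.abs_rn_le_two_zpow hp1 (by rw [← hU4]; linarith)
  rcases le_or_gt 0 yl with hyl0 | hyl0
  · ------------------------------------------------------------------ yℓ ≥ 0: yc = yh⁺
    have hz0 : 0 ≤ z := by rw [← hz]; exact hRN.nonneg (mul_nonneg hyl0 hc0)
    have hzU : z ≤ (2 : ℝ) ^ (e - p + 1) := by
      have := hRN.abs_rn_le_two_zpow hp1 (k := e - p + 1) (w := yl * c) (by linarith)
      rw [hz] at this; exact (abs_le.1 this).2
    -- the successor yh + U is a float
    obtain ⟨K, hK⟩ := hyh.exists_int_mul_of_le (e := e) (by rw [abs_of_pos hyh0]; exact he)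
    have hKp : K < 2 ^ p := by
      have : (K : ℝ) * (2 : ℝ) ^ (e - p + 1) < ((2 ^ p : ℤ) : ℝ) * (2 : ℝ) ^ (e - p + 1) := by
        push_cast; rw [← hK]; exact hyhU
      exact_mod_cast lt_of_mul_lt_mul_right this hU.le
    have hK0 : 0 < K := by
      have : (0 : ℝ) < K := by
        by_contra hle; push Not at hle
        have := mul_nonpos_of_nonpos_of_nonneg hle hU.le; linarith
      exact_mod_cast this
    have hsucc : IsFloat p (yh + (2 : ℝ) ^ (e - p + 1)) := by
      have hf := IsFloat.of_abs_le hp1 (K := K + 1) (E := e - p + 1)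
        (by rw [abs_of_pos (by linarith)]; exact Int.add_one_le_iff.mpr hKp)
      have e1 : yh + (2 : ℝ) ^ (e - p + 1) = ((K + 1 : ℤ) : ℝ) * (2 : ℝ) ^ (e - p + 1) := by
        rw [hK]; push_cast; ring
      rw [e1]; exact hf
    have hyc1 : yh ≤ yc := by rw [← hyc]; exact hRN.le_rn_of_le hyh (by linarith)
    have hyc2 : yc ≤ yh + (2 : ℝ) ^ (e - p + 1) := by
      rw [← hyc]; exact hRN.rn_le_of_le hsucc (by linarith)
    have hyc3 : yh < yc := lt_of_le_of_ne hyc1 (Ne.symm hfail)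
    have hycE : yc = yh + (2 : ℝ) ^ (e - p + 1) :=
      le_antisymm hyc2 (hyh.add_ulp_le_of_lt hyc_fl he hyc3)
    -- |yℓ| ≥ U/8
    have hyl8 : (2 : ℝ) ^ (e - p + 1) / 8 ≤ yl := by
      by_contra hlt; push Not at hlt
      have hz4 := hsmall (by rw [abs_of_nonneg hyl0]; exact hlt)
      rw [abs_of_nonneg hz0] at hz4
      apply hfail
      rw [← hyc]
      rcases he.lt_or_eq with hne2 | heq2
      · exact hRN.rn_eq_of_abs_sub_lt_half_ulp hp1 hyh hne2
          (by rw [show yh - (yh + z) = -z by ring, abs_neg, abs_of_nonneg hz0]; linarith)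
      · rw [← heq2]
        exact hRN.rn_eq_two_zpow hp1 (by linarith) (by linarith)
    -- y is between yh and yc
    have hy1 : yh ≤ y := by have := (abs_le.1 hα).2; linarith
    have hy2 : y ≤ yc := by
      have := (abs_le.1 hα).1
      rw [abs_of_nonneg hyl0] at hylU
      rw [hycE]; linarith
    rw [min_eq_left hyc1, max_eq_right hyc1]
    have hgap : ∀ f : ℝ, IsFloat p f → yh < f → f < yc → False := by
      intro f hf h1 h2
      have := hyh.add_ulp_le_of_lt hf he h1
      rw [hycE] at h2; linarith
    exact ⟨hyc_fl, hgap, hy1, hy2, hRN.rn_eq_or_eq_of_consecutive hyh hyc_fl hgap hy1 hy2⟩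
  · ------------------------------------------------------------------ yℓ < 0: yc = yh⁻
    have hz0 : z ≤ 0 := by rw [← hz]; exact hRN.nonpos (mul_nonpos_of_nonpos_of_nonneg hyl0.le hc0)
    have hyc1 : yc ≤ yh := by rw [← hyc]; exact hRN.rn_le_of_le hyh (by linarith)
    have hyc3 : yc < yh := lt_of_le_of_ne hyc1 hfail
    rw [min_eq_right hyc1, max_eq_left hyc1]
    rcases he.lt_or_eq with hne2 | heq2
    · ---------------------------------------------------------------- yh not a power of two
      have hzU : -(2 : ℝ) ^ (e - p + 1) ≤ z := by
        have := hRN.abs_rn_le_two_zpow hp1 (k := e - p + 1) (w := yl * c) (by linarith)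
        rw [hz] at this; exact (abs_le.1 this).1
      -- the predecessor yh − U is a float
      obtain ⟨K, hK⟩ := hyh.exists_int_mul_of_le (e := e) (by rw [abs_of_pos hyh0]; exact he)
      have hKp : K < 2 ^ p := by
        have : (K : ℝ) * (2 : ℝ) ^ (e - p + 1) < ((2 ^ p : ℤ) : ℝ) * (2 : ℝ) ^ (e - p + 1) := by
          push_cast; rw [← hK]; exact hyhU
        exact_mod_cast lt_of_mul_lt_mul_right this hU.le
      have hK0 : 0 < K := by
        have : (0 : ℝ) < K := by
          by_contra hle; push Not at hle
          have := mul_nonpos_of_nonpos_of_nonneg hle hU.le; linarith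
        exact_mod_cast this
      have hpred : IsFloat p (yh - (2 : ℝ) ^ (e - p + 1)) := by
        have hf := IsFloat.of_abs_le hp1 (K := K - 1) (E := e - p + 1)
          (by rw [abs_of_nonneg (by linarith)]; linarith)
        have e1 : yh - (2 : ℝ) ^ (e - p + 1) = ((K - 1 : ℤ) : ℝ) * (2 : ℝ) ^ (e - p + 1) := by
          rw [hK]; push_cast; ring
        rw [e1]; exact hf
      have hyc2 : yh - (2 : ℝ) ^ (e - p + 1) ≤ yc := by
        rw [← hyc]; exact hRN.le_rn_of_le hpred (by linarith)
      have hycE : yc = yh - (2 : ℝ) ^ (e - p + 1) :=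
        le_antisymm (IsFloat.le_sub_ulp_of_lt hp1 hyh hyc_fl hne2 hyc3) hyc2
      -- |yℓ| ≥ U/8
      have hyl8 : (2 : ℝ) ^ (e - p + 1) / 8 ≤ -yl := by
        by_contra hlt; push Not at hlt
        have hz4 := hsmall (by rw [abs_of_neg hyl0]; exact hlt)
        apply hfail
        rw [← hyc]
        exact hRN.rn_eq_of_abs_sub_lt_half_ulp hp1 hyh hne2
          (by rw [show yh - (yh + z) = -z by ring, abs_neg]; linarith)
      have hy1 : y ≤ yh := by have := (abs_le.1 hα).1; linarith
      have hy2 : yc ≤ y := by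
        have := (abs_le.1 hα).2
        rw [abs_of_neg hyl0] at hylU
        rw [hycE]; linarith
      have hgap : ∀ f : ℝ, IsFloat p f → yc < f → f < yh → False := by
        intro f hf h1 h2
        have := IsFloat.le_sub_ulp_of_lt hp1 hyh hf hne2 h2
        rw [hycE] at h1; linarith
      refine ⟨hyc_fl, hgap, hy2, hy1, ?_⟩
      rcases hRN.rn_eq_or_eq_of_consecutive hyc_fl hyh hgap hy2 hy1 with h | h
      · exact Or.inr h
      · exact Or.inl h
    · ---------------------------------------------------------------- yh = 2^e
      have hyh2 : yh = (2 : ℝ) ^ e := heq2.symm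
      have h4' : RN ((2 : ℝ) ^ e + yl) = (2 : ℝ) ^ e := by rw [← hyh2]; exact h4
      have hylq : -yl ≤ (2 : ℝ) ^ (e - p + 1) / 4 := hRN.neg_le_quarter_ulp_of_test_pow2 hyl0.le h4'
      -- |yℓ c| ≤ U/2 = 2^(e-p), so z ≥ −2^(e−p)
      have hzU : -(2 : ℝ) ^ (e - p) ≤ z := by
        have := hRN.abs_rn_le_two_zpow hp1 (k := e - p) (w := yl * c)
          (by rw [← hU2]; rw [abs_of_neg hyl0] at hylc; linarith)
        rw [hz] at this; exact (abs_le.1 this).1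
      have hpred : IsFloat p ((2 : ℝ) ^ e - (2 : ℝ) ^ (e - p)) := IsFloat.pred_two_zpow e
      have hyc2 : (2 : ℝ) ^ e - (2 : ℝ) ^ (e - p) ≤ yc := by
        rw [← hyc]; exact hRN.le_rn_of_le hpred (by rw [hyh2]; linarith)
      have hycE : yc = (2 : ℝ) ^ e - (2 : ℝ) ^ (e - p) :=
        le_antisymm (hyc_fl.le_sub_of_lt hp1 (by rw [← hyh2]; exact hyc3)) hyc2
      -- |yℓ| ≥ U/8 (the ties-to-even rule enters when RN(yℓ e) = −¼ulp exactly)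
      have hyl8 : (2 : ℝ) ^ (e - p + 1) / 8 ≤ -yl := by
        by_contra hlt; push Not at hlt
        have hz4 := hsmall (by rw [abs_of_neg hyl0]; exact hlt)
        rw [abs_of_nonpos hz0, hU4] at hz4
        apply hfail
        rw [← hyc, hyh2]
        rcases hz4.lt_or_eq with hlt4 | heq4
        · exact hRN.rn_eq_two_zpow hp1 (by rw [hU4]; linarith) (by linarith)
        · rw [show z = -(2 : ℝ) ^ (e - p - 1) by linarith, ← sub_eq_add_neg]
          exact hRN.rn_two_zpow_sub_quarter_ulp hTE hp1 e
      have hy1 : y ≤ yh := by have := (abs_le.1 hα).1; linarith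
      have hy2 : yc ≤ y := by
        have h' := (abs_le.1 hα).2
        have : (2 : ℝ) ^ e - (2 : ℝ) ^ (e - p) ≤ y := by
          rw [← hU2, ← hyh2]; linarith only [h', hylq, hεy, hU]
        rw [hycE]; exact this
      have hgap : ∀ f : ℝ, IsFloat p f → yc < f → f < yh → False := by
        intro f hf h1 h2
        have := hf.le_sub_of_lt hp1 (by rw [← hyh2]; exact h2)
        rw [hycE] at h1; linarith
      refine ⟨hyc_fl, hgap, hy2, hy1, ?_⟩
      rcases hRN.rn_eq_or_eq_of_consecutive hyc_fl hyh hgap hy2 hy1 with h | h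
      · exact Or.inr h
      · exact Or.inl h

end Failure


end Literature.ComputerArithmetic.DeDinechinLauterMullerTorres2013
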